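import Mathlib
import HarnessLib
import HarnessLib.Audit
import Summits.AnomalousDissipation.Statement
import Literature.Analysis.FluidPDE.StatisticalSolution
import Literature.Analysis.FunctionSpaces.TorusTrigPoly
import HarnessLib.Audit.Status.Attr

/-!
Route: MomentParity

DORMANT since 2026-08-24T07:11:26Z (reconciler: no traction for 6.6 d (last activity item-evidence-added at 2026-08-17T16:49:03Z); parked, not closed — `ledger route dormant route-AnomalousDissipation-MomentParity --off` to reactivate) — unstaffed, not closed; items shared with open routes are served there. `ledger route dormant <id> --off` reactivates.

# Route MomentParity — fake turbulence order by order — loud moment-stationary Galerkin measures,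
closed in d and realised by one Leray–Hopf path

It suffices to show X = MomentLadder (card fake-it-to-third-order-moment-parity, its ladder (L)/K2
made exact): for SOME smooth steady
divergence-free mean-zero force f, viscosities ν_j → 0 and budgets E, ε > 0, at every j there are a
support radius R and a resolution
schedule κ : ℕ → ℕ such that for infinitely many Galerkin levels N and EVERY moment order d there is
a Borel probability measure μ on
H = L²_σ(T³) carried by the level-N Fourier–Galerkin fields (û(k) = 0 off 0 < |k| ≤ N), supported in
‖u‖ ≤ R, with RESOLVED dissipation
(∫‖∇u‖²dμ ≤ ∫‖∇P_{κ(n)}u‖²dμ + 1/(n+1) for all n), which is d-STATIONARY for Galerkin NS at (ν_j,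
P_N f) — ∫⟨F(u), ∇p(u)⟩dμ = 0 for every
polynomial p of degree ≤ d−1 in finitely many pairings (u, g_i) with band-limited smooth solenoidal
test fields g_i (on such measures the
Foias–Prodi generator pairing IS the Galerkin generator) — and LOUD: ∫|u|²dμ ≤ E, ν_j∫‖∇u‖²dμ ≥ ε. R
uniform in N and d costs nothing for
genuine invariant measures (absorbing ball ‖u‖ ≤ ‖f‖₂/(4π²ν)); κ — N-uniform resolution of the
dissipation at FIXED ν, physically the
cutoff at k_η(ν) — is NOT free in 3-D (only the mean energy INEQUALITY is known for Galerkin-limit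
stationary statistical solutions, FMRT2001
Def. IV.1.3 (1.31); flagged by the 2026-08-15 retriage) and is the crux ResolvedDissipation. So X ⟺
"loud Galerkin-invariant measures with
N-uniformly resolved dissipation along ν_j → 0", and THIS route takes the d = ∞ rung at once:
GalerkinInvariantLoud (loud bounded
Galerkin-invariant ensembles, N-frequently, along ν_j → 0) ∧ ResolvedDissipation (fixed-ν
resolution) conclude X by pure logic (support
LadderGlue, proved). The rung-by-rung reading of the same X — d = 3 free in 3-D by parity
(CubicParityLoud), d = 4 the gate (QuarticGate),
order-4 tightness (QuarticTightness), resolution for the loud family (UniformResolution), glue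
LadderGlue2 — is, since the 2026-08-16 split
(route-choice, crux-cap; D-0019: an alternative decomposition is a separate route sharing the
decls), route QuarticLadder: same target, shared
ledger rows, its own crux-only deciding theorem; those decls stay listed here as support (necessary
conditions / kill criteria). X itself is kind crux
(rank 0) by the operator's ruling of 2026-08-16 — conjecture-grade and in the cone — in both routes.
Lean: `∃ f : UnitAddTorus (Fin 3) → EuclideanSpace ℝ (Fin 3),
Literature.Analysis.FunctionSpaces.Torus.IsSmooth f ∧
Literature.Analysis.FunctionSpaces.Torus.IsDivFree f ∧
Literature.Analysis.FunctionSpaces.Torus.HasZeroMean f ∧ ∃ (ν : ℕ → ℝ) (E ε : ℝ), (∀ j, 0 < ν j) ∧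
Filter.Tendsto ν Filter.atTop (nhds 0) ∧ 0 < ε ∧ ∀ j : ℕ, ∃ (R : ℝ) (κ : ℕ → ℕ), ∃ᶠ N in
Filter.atTop, ∀ d : ℕ, ∃ μ : MeasureTheory.Measure
(Literature.Analysis.FunctionSpaces.Torus.energySpace (Fin 3)), MeasureTheory.IsProbabilityMeasure μ
∧ (∀ᵐ (u : Literature.Analysis.FunctionSpaces.Torus.energySpace (Fin 3)) ∂μ, (∀ k ∉
(Literature.Analysis.FunctionSpaces.Torus.freqBall N).erase (0 : Fin 3 → ℤ),
UnitAddTorus.mFourierCoeff (Literature.Analysis.FunctionSpaces.EuclideanSpace.complexify ∘ (u.1 :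
UnitAddTorus (Fin 3) → EuclideanSpace ℝ (Fin 3))) k = 0)) ∧ (∀ᵐ u ∂μ, ‖u‖ ≤ R) ∧ (∀ n : ℕ, ∫⁻ (u :
Literature.Analysis.FunctionSpaces.Torus.energySpace (Fin 3)),
Literature.Analysis.FunctionSpaces.Torus.eGradNormSq (u.1 : UnitAddTorus (Fin 3) → EuclideanSpace ℝ
(Fin 3)) ∂μ ≤ (∫⁻ (u : Literature.Analysis.FunctionSpaces.Torus.energySpace (Fin 3)),
Literature.Analysis.FunctionSpaces.Torus.eGradNormSq
(Literature.Analysis.FunctionSpaces.Torus.fourierTruncate (κ n) (u.1 : UnitAddTorus (Fin 3) →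
EuclideanSpace ℝ (Fin 3))) ∂μ) + ((n : ENNReal) + 1)⁻¹) ∧ (∀ (m : ℕ) (g : Fin m → UnitAddTorus (Fin
3) → EuclideanSpace ℝ (Fin 3)) (P : MvPolynomial (Fin m) ℝ), (∀ i,
(Literature.Analysis.FunctionSpaces.Torus.IsSmooth (g i) ∧
Literature.Analysis.FunctionSpaces.Torus.IsDivFree (g i) ∧
Literature.Analysis.FunctionSpaces.Torus.HasZeroMean (g i) ∧ (∀ k ∉
(Literature.Analysis.FunctionSpaces.Torus.freqBall N).erase (0 : Fin 3 → ℤ),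
UnitAddTorus.mFourierCoeff (Literature.Analysis.FunctionSpaces.EuclideanSpace.complexify ∘ (g i)) k
= 0))) → P.totalDegree + 1 ≤ d → MeasureTheory.Integrable (fun u =>
Literature.Analysis.FluidPDE.Torus.nsGeneratorPairing (ν j) f u (fun x => ∑ i : Fin m,
(MvPolynomial.eval (fun j => Literature.Analysis.FluidPDE.Torus.pairing u.1 (g j))
(MvPolynomial.pderiv i P)) • g i x)) μ ∧ ∫ u, Literature.Analysis.FluidPDE.Torus.nsGeneratorPairing
(ν j) f u (fun x => ∑ i : Fin m, (MvPolynomial.eval (fun j =>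
Literature.Analysis.FluidPDE.Torus.pairing u.1 (g j)) (MvPolynomial.pderiv i P)) • g i x) ∂μ = 0) ∧
Literature.Analysis.FluidPDE.Torus.ensembleEnergy μ ≤ E ∧ ε ≤
Literature.Analysis.FluidPDE.Torus.ensembleDissipation (ν j) μ`

## Assembly
Crux-only deciding theorem (2026-08-16 badge repair; glue.lean `closes`, sorry-free against the
rendered items, axioms
propext/Classical.choice/Quot.sound): closes : GalerkinInvariantLoud → ResolvedDissipation →
LadderGlue → MomentClosure →
GalerkinEnsembleRealization → AnomalousDissipation. Its binders are the two cruxes of the ACTIVE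
decomposition of X (GalerkinInvariantLoud,
ResolvedDissipation), the PROVED glue LadderGlue : GalerkinInvariantLoud → ResolvedDissipation →
MomentLadder (Theorems/MomentParityLadderGlue),
the PROVED support MomentClosure (Theorems/MomentParityMomentClosure) and
GalerkinEnsembleRealization (unproved, hence re-badged crux by the gate's crux-only rule — only crux
or proved items may be binders); the target MomentLadder is
DERIVED inside (first line `hL hG hRes`), so X is no hypothesis of closes. Then: unpack f, ν_j, E, ε
from MomentLadder; at each j take R, κ and
the frequently-many N; MomentClosure (a ∀-statement at fixed (f, ν_j, N, E, ε, R, κ)) turns "∀ d ∃ μ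
d-stationary loud" into "∃ μ invariant loud"
inside the `∃ᶠ N` (Filter.Frequently.mono); GalerkinEnsembleRealization with its j-INDEPENDENT M(f,
E, ε) gives per j one global Leray–Hopf
trajectory with meanEnergy ≤ M and meanDissipation ≥ ε/2; these witness Literature.Turb.ZerothLaw =
AnomalousDissipation with constants M, ε/2.
Below the binders, SUPPORT since the split: QuarticGate and CubicParityLoud are the d = 4 and d = 3
rungs BELOW GalerkinInvariantLoud
(necessary conditions — bounded support gives the fourth moments — so ¬QuarticGate ⇒
¬GalerkinInvariantLoud stays the sharpest kill
criterion), QuarticTightness/UniformResolution/CubicClimb and the proved glues LadderGlue2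
(QuarticGate → QuarticTightness → UniformResolution
→ MomentLadder) and LadderGlue3 (CubicParityLoud → CubicClimb → QuarticGate) are the ladder
decomposition now carried, ranked and decided by
route QuarticLadder (QuarticGate r2, QuarticTightness r3, UniformResolution r4, CubicParityLoud r5,
GalerkinEnsembleRealization r6 there);
every one of these decls is referenced by landed Theorems files, so none is dropped — they are
re-kinded, not removed. The proved item Assembly : MomentLadder → MomentClosure →
GalerkinEnsembleRealization → AnomalousDissipation (Theorems/MomentParityAssembly) is the pre-repair
shape of closes and stays true.

Rationale: WHY THIS LINE. Moment–SOS duality (in fluids: doi:10.1137/15m1053347,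
doi:10.1016/j.physleta.2017.12.023, arXiv:2010.06730; for invariant measures of polynomial
systems arXiv:1807.08956, doi:10.3934/dcdsb.2019165) is used on the WITNESS side, as proof
complexity uses dual witnesses to lower-bound certificate
degree (doi:10.1016/s0304-3975(00)00157-2, doi:10.1109/focs.2016.53): instead of certificates
bounding dissipation we ask for TRUE probability
measures on Galerkin phase space whose dynamics is faked only beyond moment order d. Imported:
truncated-moment theory (odd-degree realizability is
vacuous once the covariance is definite, arXiv:0908.3230; flat extensions, doi:10.1090/memo/0568),
Kraichnan's rugged quadratic invariants E, H of
truncated 3-D Euler (doi:10.1017/s0022112073001837) — whence the PARITY criterion: order 3 is linear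
algebra with range (quadratic Casimirs)^⊥,
loud in 3-D because helicity is indefinite, quiet in 2-D because enstrophy is definite
(PlanarCubicQuiet = Alexakis–Doering
doi:10.1016/j.physleta.2006.07.048 as a range condition) — and closure theory's oldest pathology
(quasi-normal realizability failure,
doi:10.1017/s0022112063000562, doi:10.1017/s0022112070000642) turned into the exact first gate,
QuarticGate. Downstream the line is ergodic
theory of dissipative PDE: MomentClosure (compactness in d on the compact set P_N H ∩ B_R; FMRT2001
Ch. IV App. B, PDF pp. 249–250) and
GalerkinEnsembleRealization (Vishik–Fursikov limits of stationary Galerkin laws,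
doi:10.1137/130931631, arXiv:1606.02174; Birkhoff + Chebyshev).
What prior routes do not do: Ensemble needs realisation of ARBITRARY Foias–Prodi measures (its open
crux EnsembleRealization) — here only
Galerkin-limit measures occur, the known case, and the resolved-dissipation clause removes
Leray–Hopf leakage; MirrorVariety/WindLine need loud
STEADY Galerkin states (Dirac measures, a corner of X) and DecimationAxis needs T₀-uniform running
averages — X asks only for invariant measures,
the weakest finite-dimensional form, graded by moment order; and CubicParityLoud hands route Neg a
barrier of a new logical type (a disproof
must use stationarity of an observable of degree ≥ 3 plus order-4 positivity), complementary to
Cheskidov's force-robustness barrier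
(arXiv:2311.04182 Thm 1.3).

RANKED CRUXES. #0 MomentLadder (CRUX rank 0 by the operator's ruling 2026-08-16T07:39Z — X itself,
conjecture-grade, in the cone: derived inside closes via the proved LadderGlue, so no hypothesis;
shared with route QuarticLadder) — X as in § Thesis: ∃ f smooth div-free mean-zero, ν_j → 0, E, ε >
0, ∀ j ∃ R κ, for infinitely many N, ∀ d, a level-N-carried probability measure on H with support in
‖u‖ ≤ R, κ-resolved dissipation, d-stationary for Galerkin NS (polynomial cylindrical tests of
degree ≤ d−1 with band-limited fields), mean energy ≤ E, dissipation ≥ ε (card ladder (L)/K2 with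
the uniformity made explicit). (why it might fail: it is the zeroth law as seen by converged DNS:
false iff every bounded-energy Galerkin-invariant family laminarises N-uniformly as ν → 0 or needs
an N-dependent dissipation cutoff; its 2-D analogue IS false (PlanarCubicQuiet, Alexakis–Doering).)
[FMRT2001, doi:10.1017/s0022112073001837, arXiv:2311.04182, doi:10.1063/1.1539855,
doi:10.1016/j.physleta.2006.07.048]
#4 GalerkinInvariantLoud (crux; binder 1 of closes; THE TOP CRUX of this route since the split —
rank 4 as filed, nothing ranks above it here) — the d = ∞ rung, X with `∀ d` moved inside and the
resolution clause split off: ∃ f smooth div-free mean-zero, ν_j → 0, E, ε > 0, ∀ j ∃ R, for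
infinitely many N, a level-N-carried probability measure on H supported in ‖u‖ ≤ R, STATIONARY for
Galerkin NS at (ν_j, f) against every polynomial cylindrical observable with band-limited fields
(all degrees; on compactly supported level-N measures = flow-invariance, Liouville), mean energy ≤
E, dissipation ≥ ε. The zeroth law in its weakest finite-dimensional form (Galerkin-invariant
ensembles, e.g. Krylov–Bogoliubov time averages of the truncated dynamics, for which R =
|f|/(4π²ν_j) is free and ν⟨‖∇u‖²⟩ = ⟨(f,u)⟩ = (f, ū) exactly: loud ⟺ the mean flow keeps an O(1)
projection on the force at bounded energy); implies QuarticGate. [difficulty: XL] (why it might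
fail: false iff for every force every bounded-energy family of level-N invariant measures has (f,
ū_{ν,N}) → 0 N-frequently as ν → 0 — uniform laminarisation/depletion, as in 2-D by Alexakis–Doering
ε ≲ ν^{1/2}; Cheskidov's force-robustness arXiv:2311.04182 Thm 1.3 makes the ∃ f load-bearing.)
[FMRT2001, doi:10.1017/s0022112002001386, doi:10.1017/s0022112073001837, doi:10.1063/1.1539855,
arXiv:2311.04182, doi:10.1016/j.physleta.2006.07.048]
#5 ResolvedDissipation (crux; binder 2 of closes) — no enstrophy leakage at FIXED viscosity: for
every smooth div-free mean-zero f, every ν > 0 and every R there is ONE schedule κ : ℕ → ℕ such that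
for EVERY level N and EVERY level-N-carried probability measure supported in ‖u‖ ≤ R and stationary
for Galerkin NS at (ν, f) against all polynomial cylindrical band-limited observables: ∫‖∇u‖²dμ ≤
∫‖∇P_{κ(n)}u‖²dμ + 1/(n+1) for all n. Up to subsequences ⟺ weak limits N → ∞ of such invariant
families (Vishik–Fursikov / FMRT stationary statistical solutions) satisfy the mean energy EQUALITY
ν⟨‖∇u‖²⟩ = ⟨(f,u)⟩ instead of FMRT's inequality IV (1.31); physically the dissipation spectrum is
cut off at k_η(ν) uniformly in the truncation. Known N-uniform input: ν⟨‖∇u‖²⟩ = ⟨(f,u)⟩ ≤ |f|R at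
each N, ⟨|Au|^{2/3}⟩ ≤ c (Foias–Guillopé–Temam, FMRT IV (3.6)); Diracs at steady states pass
(elliptic bootstrap ‖Au_N‖ ≤ C(ν,R,f)). The d = 2 analogue is proved in tree
(`Torus.IsStationaryStatisticalSolution.energy_eq_holds`,
Literature.Analysis.FluidPDE.StatisticalSolutionEnergyEq: finite mean enstrophy + Liouville suffice
because the 2-D cutoff flux is dominated by ‖∇u‖²); the 3-D domination is exactly what is asked. The
clause that makes GalerkinEnsembleRealization lossless; fixed-ν and regularity-flavoured,
independent of ν → 0. [difficulty: L] (why it might fail: it forces the mean energy equality for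
every Galerkin-limit stationary statistical solution at fixed ν, known in 3-D only as an inequality;
N-uniform control stops at ⟨‖∇u‖²⟩ and ⟨|Au|^{2/3}⟩, so an intermittent stationary ensemble could
park a fixed fraction of its enstrophy at the cutoff shell as N → ∞ — the ensemble shadow of strict
Leray–Hopf energy inequality.) [FMRT2001, doi:10.1080/03605308108820180, arXiv:0704.0759,
doi:10.1137/130931631, arXiv:1606.02174]
#4s GalerkinEnsembleRealization (crux, rank 4, lowest priority: binder 5 of closes and unproved —
only crux or proved items may be binders; also binder of QuarticLadder's closes; 11 support files
landed toward it) — for f smooth div-free mean-zero and E, ε > 0 there is M = M(f, E, ε) (M =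
4‖f‖₂²E²/ε² + 1 works) such that for every ν > 0, R, κ: if for infinitely many N there is a
Galerkin-invariant probability measure at level N (generator identity for every cylindrical test
with band-limited fields), supported in ‖u‖ ≤ R, with κ-resolved dissipation, mean energy ≤ E and
dissipation ≥ ε, then ONE global Leray–Hopf solution of NS_ν forced by f has limsup-mean energy ≤ M
and limsup-mean dissipation ≥ ε/2. Plan: stationary Galerkin laws are tight on C([0,∞);H_w) ∩
L²_loc(H); the shift-invariant Vishik–Fursikov limit is carried by Leray–Hopf paths (the KNOWN
Galerkin-limit case of Ensemble's EnsembleRealization); the tail clause passes the enstrophy of the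
time-0 marginal to the limit (no leakage); Birkhoff on path space and Chebyshev against the pathwise
bound ν⟨‖∇u‖²⟩ ≤ ‖f‖₂⟨|u|²⟩^{1/2} select the path. [difficulty: L] (why it might fail: bookkeeping,
not truth: the selected VF-limit path must be Leray–Hopf in the tree's strict sense (energy
inequality from s = 0 for EVERY t, strong continuity at 0⁺, the weak-solution test class), known
only from a.e. initial time — re-root by stationarity/Fubini; heavy.) [doi:10.1137/130931631,
arXiv:1606.02174, doi:10.1007/s10955-015-1248-3, doi:10.1016/j.crma.2009.12.018, arXiv:math/0602612,
FMRT2001]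
#9 LadderGlue (support, PROVED — Theorems/MomentParityLadderGlue `ladderGlue_proof`; binder 3 of
closes) — GalerkinInvariantLoud → ResolvedDissipation → MomentLadder, pure logic: R from the first
crux, κ from the second at (f, ν_j, R), the degree hypothesis dropped inside `∃ᶠ N`.
#9 MomentClosure (support, PROVED — Theorems/MomentParityMomentClosure `momentClosure_proof`; binder
4 of closes; used by name in QuarticLadder's closes) — at fixed (f, ν, N, E, ε, R, κ): loud
d-stationary measures for every d with the common support ball and tail schedule ⇒ one loud
Galerkin-invariant measure with the same bounds (weak-* compactness on P_N H ∩ B_R; polynomial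
density on compacta). [FMRT2001, doi:10.3934/dcdsb.2019165, arXiv:1807.08956]
#9 UniformResolution (support; crux r4 and binder of route QuarticLadder) — the existential twin of
ResolvedDissipation along the loud family: for every f, ν_j → 0, E, ε, if at every j there is R such
that for infinitely many N and every d a level-N probability measure supported in ‖u‖ ≤ R is
d-stationary with mean energy ≤ E and dissipation ≥ ε, then the same holds for some E′, ε′ TOGETHER
WITH an N-uniform resolution schedule κ_j (the full MomentLadder body). One obstruction with
ResolvedDissipation (N-uniform integrability of the enstrophy of loud invariant Galerkin laws at
fixed ν; ResolvedDissipation ∧ MomentClosure ⇒ UniformResolution modulo two bookkeeping lemmas),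
hence one badge here; kept as the pre-declared PIVOT form (KILL CRITERIA).
#9 QuarticGate (SUPPORT here since the 2026-08-16 split — crux r2 and binder 1 of route
QuarticLadder, where its truth risk is ranked, staffed and decided; its crux chain
Cruxes/QuarticGate is unaffected, crux units key on the shared item stmt-11464) — the d = 4 rung: ∃
f, ν_j → 0, E, ε > 0 such that at every j, for infinitely many N, a level-N probability measure with
finite fourth moments is 4-STATIONARY (all budgets of degree ≤ 3 exact) and loud. Role in THIS
route: necessary condition of GalerkinInvariantLoud (bounded support gives the fourth moments) — the
sharpest kill criterion — and off the deciding path (the gate's native cone audit of rev 10 listed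
it `unused`; re-kinded rather than dropped because ~90 landed Theorems files reference the decl).
[doi:10.1016/j.physleta.2017.12.023, arXiv:1807.08956, doi:10.1017/s0022112063000562,
doi:10.1017/s0022112070000642, arXiv:0908.3230]
#9 CubicParityLoud (SUPPORT here since the split — crux r5 of QuarticLadder; crux chain
Cruxes/CubicParityLoud unaffected) — the d = 3 rung, free in 3-D by parity: for EVERY f ≠ 0 there
are E, ε, ν₀ with loud 3-stationary level-N measures for ν < ν₀, N ≥ N₀(ν) ≍ ν^{-1/2}; order 3 is
linear algebra with range {E, H}^⊥ (helicity indefinite ⇒ loud; enstrophy definite in 2-D ⇒ quiet,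
PlanarCubicQuiet). Role here: the parity mechanism's first theorem and the barrier corollary for
route Neg (no disproof through budgets of degree ≤ 2); with CubicClimb an alternative derivation of
QuarticGate (LadderGlue3, proved). [doi:10.1017/s0022112073001837, arXiv:0908.3230,
doi:10.1016/j.physleta.2006.07.048, arXiv:2311.04182]
#9 QuarticTightness (SUPPORT here since the split — crux r3 and binder 2 of QuarticLadder; crux
chain Cruxes/QuarticTightness unaffected) — order-4 tightness along ν_j → 0: the QuarticGate body
for a force ⇒ for some budgets, at every j a common support radius and, for infinitely many N and
EVERY d, loud d-stationary level-N measures (the MomentLadder body minus resolution). Here it only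
glued the ladder decomposition (LadderGlue2); ¬QuarticTightness has no effect on this route's
closes. [arXiv:1807.08956, arXiv:2010.06730, arXiv:2606.12825]
#9 CubicClimb (support, both routes) — the climbing step d = 3 → 4 along ν_j → 0 (3-stationary loud
families ⇒ the QuarticGate body for some budgets; Tchakaloff tail exchange + far-atom order-4
surgery; unproved input ∃ᶠ N NoCubicCasimir N = stub S2 of QuarticGate's lines). #9 LadderGlue2
(support, PROVED `ladderGlue2_proof`) — QuarticGate → QuarticTightness → UniformResolution →
MomentLadder; #9 LadderGlue3 (support, PROVED `ladderGlue3_proof`, landed 2026-08-16 07:36Z) —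
CubicParityLoud → CubicClimb → QuarticGate: the two glues of the ladder decomposition, used by route
QuarticLadder. #9 PlanarCubicQuiet (support) — on T²: 3-stationary level-N measures with mean energy
≤ E dissipate ≤ ‖Δf‖₂^{1/2}E^{3/4}√ν (Alexakis–Doering as quadratic stationarity's enstrophy range
condition). [doi:10.1016/j.physleta.2006.07.048]

TWO-LAYER PLAN. Foreseen glued splits (none filed now): GalerkinEnsembleRealization ⇐ VFLimit
(stationary level-N laws ⇒ a shift-invariant measure on
Leray–Hopf paths whose time-0 marginal keeps energy ≤ E and, by the tail clause, enstrophy ≥ ε/ν) →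
BirkhoffSelection (ergodic decomposition +
Chebyshev, M = 4‖f‖₂²E²/ε² + 1) → GalerkinEnsembleRealization. MomentLadder is split by CLAUSES, not
rungs: MomentLadder ⇐ GalerkinInvariantLoud
(d = ∞: loudness with bounded support, N-frequently, along ν_j → 0) ∧ ResolvedDissipation (N-uniform
resolution of the mean enstrophy of
invariant measures at fixed ν) through the pure-logic glue LadderGlue (proved) — the ONE active
decomposition of this route; children of the two
cruxes ride as `--supports` (their crux chains: Cruxes/GalerkinInvariantLoud,
Cruxes/ResolvedDissipation), never as items. DECOMPOSITION LEDGER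
after the 2026-08-16 split: the rung-by-rung decomposition QuarticGate ∧ QuarticTightness ∧
UniformResolution (glue LadderGlue2 ✓) with
QuarticGate ⇐ CubicParityLoud ∧ CubicClimb (glue LadderGlue3 ✓) is route QuarticLadder
(route-AnomalousDissipation-QuarticLadder, opened by the
route-choice seat; same X, 8 shared rows + 4 duplicate rows of this route's proved items; closes :
QuarticGate → QuarticTightness →
UniformResolution → GalerkinEnsembleRealization → Statement using `ladderGlue2_proof` /
`momentClosure_proof` by name). Items here: 15 = cap,
cruxes 4 (X + the three binders) — no further items in this route.

KILL CRITERIA. ¬GalerkinInvariantLoud ⇒ ¬MomentLadder given MomentClosure (provable-now): close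
`refuted:GalerkinInvariantLoud` (no N-uniform Galerkin-ensemble zeroth law for any force — the
strongest negative this line can produce). ¬ResolvedDissipation (a leaking bounded invariant family
at fixed ν) is a PIVOT, not a kill: MomentLadder only needs resolution for its own witnessing
family, and that existential form is ALREADY filed as the support UniformResolution — repair =
`route edit --closes-file` with closes : GalerkinInvariantLoud → UniformResolution → MomentClosure →
GalerkinEnsembleRealization → Statement (six lines of logic: full stationarity gives d-stationarity
for every d; UniformResolution returns the MomentLadder body with budgets E′, ε′), UniformResolution
re-badged crux, and the negative recorded as a fixed-ν statistical energy-equality failure.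
¬QuarticTightness kills route QuarticLadder's deciding path and records the theorem 'order-4
stationarity is not tight for loudness' — no effect on this route's closes (drop the support here).
¬UniformResolution ⇒ ¬ResolvedDissipation-for-the-loud-family: then both resolution forms are dead
and the route closes `refuted:ResolvedDissipation` unless GalerkinEnsembleRealization can be
re-proved without the tail clause (Leray–Hopf leakage accepted, dissipation floor lost) — it cannot
as stated, so that is a kill. ¬QuarticGate (for every force no loud 4-stationary family at
infinitely many N) ⇒ ¬GalerkinInvariantLoud ⇒ ¬MomentLadder: the shared row closes
refuted in both routes (route-item-refuted here on a support); honest action = land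
GalerkinInvariantLoud → QuarticGate (bounded support gives
the fourth moments; provable-now) and close `refuted:GalerkinInvariantLoud`, recording the theorem
(realizable budget-consistent fourth-order
statistics cannot be loud: essentially no N-uniform Galerkin-ensemble zeroth law).
¬CubicParityLoud (an accidental positive quadratic Casimir, or unrealizable Reynolds stress) kills
the PARITY MECHANISM, not X: drop the support and
the barrier claims here (QuarticLadder loses its alternative derivation of QuarticGate, nothing on
either deciding path). GalerkinEnsembleRealization
refuted in the tree's strict Leray–Hopf class ⇒ restate over time-average/Vishik–Fursikov paths
(pivot, not close). Literature ZerothLawNeg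
(route Neg) or Ensemble's EnsembleNeg proved ⇒ refuted outright.
MirrorVariety.GalerkinSteadyZerothLaw or WindLine proved ⇒ MomentLadder holds
with Dirac measures and `closes` fires (the route is done). QuarticLadder's closes fires first ⇒ X
holds ⇒ this route `superseded --by
route-AnomalousDissipation-QuarticLadder` unless GalerkinInvariantLoud ∧ ResolvedDissipation are
wanted as theorems in their own right.

NOT DECOMPOSED YET. The explicit force (Kolmogorov vs Taylor–Green) — X keeps ∃ f; the
Krylov–Bogoliubov / time-average construction of loud invariant
Galerkin laws and the N-uniform enstrophy-tail estimate (children of the two cruxes, `--supports`);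
the 2½-D scalar sector. Everything on the
parity / ladder side (parity lemma, null-space theorem, Casimir classifications, SDP numerics, the
step d ⇒ d + 2) now decomposes under route
QuarticLadder.

CHEAPEST FALSIFIER. Already run by the card (kit jobs j002303 / j002348 / j002350): the
accidental-Casimir null space of the cubic identity ⟨∇Q, P_K B(u,u)⟩ ≡ 0 is
EXACTLY span{E, H} in 3-D (cubic truncations K ≤ 4 = 728 modes, spherical |k|² ≤ 16, all quadratic
forms on the 26-mode cube; residuals ≤ 2e-14,
gap ≥ 0.14) and span{E, Z} in 2-D — the mechanism survives. For THIS route's deciding path the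
informative check is (iii) below; (i)–(ii) now belong to route QuarticLadder's cruxes: (i)
least-squares solve of
the order-3 system for the Kolmogorov force at N = 8, ν = 0.05 to size the third moments, the
chirality offset and the Reynolds-stress
realizability margin (kills CubicParityLoud if infeasible); (ii) Lasserre/SDP feasibility of loud
degree-4 pseudo-moments at N = 2, 3 as ν
decreases (QuarticGate's first child) — recall bounded states are quiet at fixed N (D ≤ 4π²νN²E), so
the informative quantity is the feasibility
margin along the diagonal N ≍ (ε/(4π²νE))^{1/2}. (iii) For ResolvedDissipation: at fixed ν (say
0.02) and Kolmogorov forcing, long-time averages of the Galerkin system at N = 16, 32, 64 — the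
fraction of mean enstrophy above a fixed κ must be N-independent (the standard resolved-DNS
convergence check, doi:10.1063/1.1539855); a cutoff-shell pile-up growing with N refutes it
numerically, an exponential dissipation-range tail supports it.

NUMBERS. Level-N ceiling D ≤ 4π²νN²E (so loud needs N ≥ (ε/(4π²νE))^{1/2}); absorbing ball ‖u‖ ≤
‖f‖₂/(4π²ν) (N-uniform ⇒ R = R(ν_j)); realisation
constant M = 4‖f‖₂²E²/ε² + 1; 2-D ceiling ε(μ) ≤ ‖Δf‖₂^{1/2}E^{3/4}ν^{1/2} (PlanarCubicQuiet;
Alexakis–Doering ε ≲ ν^{1/2}); quadratic null space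
dims: 2 = span{E,H} (3-D, ≤ 728 modes), 2 = span{E,Z} (2-D) (card kit jobs); order-4 cancellation
accuracy ≍ Re_λ⁻¹ (quasi-normal gate). Items:
15 = cap (opened with 7; 10 after the 03:13Z route-choice repair; 15 after the later 2026-08-16
additions). After the 2026-08-16 SPLIT: cruxes 4 = X itself
(MomentLadder r0, crux by the operator's ruling) + the binders (GalerkinInvariantLoud r4,
ResolvedDissipation r5, GalerkinEnsembleRealization r4), assembly 1 (proved),
support 10 (QuarticGate, CubicParityLoud, QuarticTightness — cruxes of QuarticLadder —,
UniformResolution, CubicClimb, PlanarCubicQuiet, and the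
glues MomentClosure ✓, LadderGlue ✓, LadderGlue2 ✓, LadderGlue3 ✓; ✓ = proved). Binders of closes: 5
(3 crux + 2 proved).

DEFINITION REQUESTS. None: `IsDStationary` / `PZL` of the card are INLINED (MvPolynomial.pderiv/eval
over Torus.pairing, Torus.nsGeneratorPairing,
freqBall/mFourierCoeff, Torus.fourierTruncate); a later `Torus.IsPolyStationary ν f N d μ` may be
introduced by provers with `--supports`.

Novelty: Searches (2026-08-15, this planner; searchd FTS leg busy, OpenAlex 429, arXiv/zbMATH 0 rows): `lit
search --hybrid "truncated moment hierarchy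
stationary statistical solution … semidefinite"` (12 books: FMRT2001 pp. 201–210 and Ch. IV App. B
pp. 249–250 READ; Kuksin–Shirikyan 2012;
Feireisl–Novotný 2022 pp. 252–257; Curto 1995; Blekherman–Parrilo–Thomas 2012; Dwoyer–Hussaini–Voigt
1985), `lit search --hybrid "Vishik Fursikov
stationary statistical solution limit of Galerkin invariant measures Birkhoff …"` (10), crossref
"Bronzi Mondaini Rosa trajectory statistical
solutions" (5: doi:10.1137/130931631, doi:10.5802/aif.2836, doi:10.1016/j.crma.2009.12.018,
doi:10.1007/s10955-015-1248-3), crossref "moment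
sum-of-squares hierarchy invariant measures polynomial dynamical systems" (6:
doi:10.3934/dcdsb.2019165, doi:10.1016/j.sysconle.2016.11.010);
plus the card's twelve crossref/galaxy/vsearch queries and the novelty audit's reads
(arXiv:1807.08956 §2–4, arXiv:0908.3230 Thm 1.3); all 38
Theses headers of this sub read for overlap.
Nearest prior art found: arXiv:1807.08956 and doi:10.3934/dcdsb.2019165 (truncated pseudo-moments
annihilating the generator on polynomial
observables with PSD moment matrices = the primal of moment-SOS for invariant measures; outer
approximations at fixed parameters, no loudness-as-ν→0
question, no realised measures, no parity); doi:10.1016/j.physleta.2017.12.023, arXiv:2010.06730,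
doi:10.1137/15m1053347 (dual/certificate
side); arXiv:0908.3230 (odd-degr  [refs: 10.1137/130931631, 10.5802/aif.2836, 10.1016/j.crma.2009.12.018, 10.1007/s10955-015-1248-3, 10.3934/dcdsb.2019165, 10.1016/j.sysconle.2016.11.010, 10.1016/j.physleta.2017.12.023, 10.1137/15m1053347, 10.1017/s0022112073001837, 1807.08956, 0908.3230, 2010.06730, 1606.02174, doi:10.1137/130931631, doi:10.5802/aif.2836, doi:10.1016/j.crma.2009.12.018, doi:10.1007/s10955-015-1248-3, doi:10.3934/dcdsb.2]

Barriers (technique_class: moment-realizability, statistical-solutions, galerkin): - technique_class: moment-realizability, statistical-solutions, galerkin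
- Literature.Barriers.AnomalousDissipation.Cheskidov2023_thm13_not_forceRobustNoAnomaly: a barrier
for NEGATIVE proofs — not engaged by the positive chain X → AnomalousDissipation; engaged and
COMPLEMENTED by the corollary of CubicParityLoud (a disproof must be non-force-robust AND use
stationarity at moment degree ≥ 3 with order-4 positivity input).
- Literature.Barriers.AnomalousDissipation.AlexakisDoering2006_energyDissipationBound: consistent
and used — PlanarCubicQuiet re-derives ε ≲ ν^{1/2} as the enstrophy range condition of quadratic
stationarity; inherited constraint: X-witnesses must be genuinely 3-D (planar level-N measures are
quiet), which the helical Taylor-shell construction is.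
- Literature.Barriers.AnomalousDissipation.Marchioro1986_globalAttraction: gravest-mode planar
forcing has only the laminar invariant measure (quiet side of the parity criterion, energy ∼ ν⁻² off
the energy clause); X needs measures off the laminar branch and CubicParityLoud says no quadratic
Lyapunov/budget argument can exclude them in 3-D at small ν; the bet is that order ≥ 4 does not
either.
- Literature.Barriers.AnomalousDissipation.BrenierDeLellisSzekelyhidi2011_cor1: not engaged — no
admissibility/selection among wild Euler solutions is invoked; every path is a fixed-ν Leray–Hopf
limit of Galerkin laws. (Onsager-roughness signature, Drivas–Eyink 2019 Lemma 1, is inherited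
through realisation: the paths are ν-

History (route lifecycle, newest last):
- 2026-08-16T03:42:05Z · AUTO-CRUX (backfill): MomentLadder — hypotheses of the deciding theorem that nothing in the route derives are cruxes (operator:999:586464)
- 2026-08-16T06:35:09Z · AUTO-CRUX (edit): MomentLadder — hypotheses of the deciding theorem that nothing in the route derives are cruxes (planner-rrepair-AnomalousDissipation-MomentPar-81b36f91-0)
- 2026-08-24T07:11:26Z · DORMANT — reconciler: no traction for 6.6 d (last activity item-evidence-added at 2026-08-17T16:49:03Z); parked, not closed — `ledger route dormant route-AnomalousDissipa (operator:999:4101931)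

sub-problem: AnomalousDissipation · status: dormant · opened planner-plancard-AnomalousDissipation-Anomalo-93e0a301-0 2026-08-15T18:06:53Z · rev 15 · ledger route-AnomalousDissipation-MomentParity
GENERATED by the gate from the ledger (D-0016/17). Provers cite these decls: `theorem foo : Summit.AnomalousDissipation.AnomalousDissipation.Theses.MomentParity.<Decl> := …` in Summits/AnomalousDissipation/AnomalousDissipation/Theorems/<Name>.lean.
-/

namespace Summit.AnomalousDissipation.AnomalousDissipation.Theses.MomentParity

open scoped BigOperators Topology Manifold Classical MeasureTheory ProbabilityTheory Matrix InnerProductSpace ComplexConjugate ContinuousMap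
open Filter Set Function TopologicalSpace MeasureTheory

attribute [summit_statement] _root_.AnomalousDissipation

open Literature.Turb

/-- item stmt-AnomalousDissipation-11463 · crux (kind.auto-crux: conjecture-grade) · rank 0 · open · by planner
why it might fail: Via MomentClosure X = loud Galerkin-invariant measures with N-uniform dissipation cutoff κ as ν→0: open; false if bounded-energy Galerkin ensembles laminarise N-uniformly (as in 2-D, Alexakis–Doering) or leak enstrophy to k→∞ at fixed ν when loud: κ is NOT free in 3-D (only energy inequality known).
sources: FMRTTurbulence2001, doi:10.1017/s0022112073001837, arXiv:2311.04182, doi:10.1063/1.1539855, doi:10.1016/j.physleta.2006.07.048, doi:10.1016/j.physleta.2017.12.023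
[target] X as in § Thesis: ∃ f smooth div-free mean-zero, ν_j → 0, E, ε > 0, ∀ j ∃ R κ, for
infinitely many N, ∀ d, a level-N-carried probability measure on H with support in ‖u‖ ≤ R,
κ-resolved dissipation, d-stationary for Galerkin NS (polynomial cylindrical tests of degree ≤ d−1
with band-limited fields), mean energy ≤ E, dissipation ≥ ε (card ladder (L)/K2 with the uniformity
made explicit). -/
@[route_item "route-AnomalousDissipation-MomentParity"]
def MomentLadder : Prop :=
  ∃ f : UnitAddTorus (Fin 3) → EuclideanSpace ℝ (Fin 3), Literature.Analysis.FunctionSpaces.Torus.IsSmooth f ∧ Literature.Analysis.FunctionSpaces.Torus.IsDivFree f ∧ Literature.Analysis.FunctionSpaces.Torus.HasZeroMean f ∧ ∃ (ν : ℕ → ℝ) (E ε : ℝ), (∀ j, 0 < ν j) ∧ Filter.Tendsto ν Filter.atTop (nhds 0) ∧ 0 < ε ∧ ∀ j : ℕ, ∃ (R : ℝ) (κ : ℕ → ℕ), ∃ᶠ N in Filter.atTop, ∀ d : ℕ, ∃ μ : MeasureTheory.Measure (Literature.Analysis.FunctionSpaces.Torus.energySpace (Fin 3)), MeasureTheory.IsProbabilityMeasure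 μ ∧ (∀ᵐ (u : Literature.Analysis.FunctionSpaces.Torus.energySpace (Fin 3)) ∂μ, (∀ k ∉ (Literature.Analysis.FunctionSpaces.Torus.freqBall N).erase (0 : Fin 3 → ℤ), UnitAddTorus.mFourierCoeff (Literature.Analysis.FunctionSpaces.EuclideanSpace.complexify ∘ (u.1 : UnitAddTorus (Fin 3) → EuclideanSpace ℝ (Fin 3))) k = 0)) ∧ (∀ᵐ u ∂μ, ‖u‖ ≤ R) ∧ (∀ n : ℕ, ∫⁻ (u : Literature.Analysis.FunctionSpaces.Torus.energySpace (Fin 3)), Literature.Analysis.FunctionSpaces.Torus.eGradNormSq (u.1 : UnitAddTorus (Fin 3) → EuclideanSpace ℝ (Fin 3)) ∂μ ≤ (∫⁻ (u : Literature.Analysis.FunctionSpaces.Torus.energySpace (Fin 3)), Literature.Analysis.FunctionSpaces.Torus.eGradNormSq (Literature.Analysis.FunctionSpaces.Torus.fourierTruncate (κ n) (u.1 : UnitAddTorus (Fin 3) → EuclideanSpace ℝ (Fin 3))) ∂μ) + ((n : ENNReal) + 1)⁻¹) ∧ (∀ (m : ℕ) (g : Fin m → UnitAddTorus (Fin 3)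 → EuclideanSpace ℝ (Fin 3)) (P : MvPolynomial (Fin m) ℝ), (∀ i, (Literature.Analysis.FunctionSpaces.Torus.IsSmooth (g i) ∧ Literature.Analysis.FunctionSpaces.Torus.IsDivFree (g i) ∧ Literature.Analysis.FunctionSpaces.Torus.HasZeroMean (g i) ∧ (∀ k ∉ (Literature.Analysis.FunctionSpaces.Torus.freqBall N).erase (0 : Fin 3 → ℤ), UnitAddTorus.mFourierCoeff (Literature.Analysis.FunctionSpaces.EuclideanSpace.complexify ∘ (g i)) k = 0))) → P.totalDegree + 1 ≤ d → MeasureTheory.Integrable (fun u => Literature.Analysis.FluidPDE.Torus.nsGeneratorPairing (ν j) f u (fun x => ∑ i : Fin m, (MvPolynomial.eval (fun j => Literature.Analysis.FluidPDE.Torus.pairing u.1 (g j)) (MvPolynomial.pderiv i P)) • g i x)) μ ∧ ∫ u, Literature.Analysis.FluidPDE.Torus.nsGeneratorPairing (ν j) f u (fun x => ∑ i : Fin m, (MvPolynomial.eval (fun j => Literature.Analysis.FluidPDE.Torus.pairing u.1 (g j)) (MvPolynomial.pderiv i P)) • g i x) ∂μ = 0) ∧ Literature.Analysis.FluidPDE.Torus.ensembleEnergy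 μ ≤ E ∧ ε ≤ Literature.Analysis.FluidPDE.Torus.ensembleDissipation (ν j) μ

/-- item stmt-AnomalousDissipation-11466 · crux · rank 4 · closed · proved by Summit.AnomalousDissipation.AnomalousDissipation.Theorems.MomentParity.galerkinEnsembleRealization_of (prover) · by planner
why it might fail: Load-bearing, unproved: the Vishik–Fursikov limit path picked by Birkhoff+Chebyshev must be Leray–Hopf in the tree's STRICT sense (energy inequality from s=0 for every t, strong continuity at 0⁺) — in print only from a.e. initial time; re-rooting by stationarity/Fubini is unwritten.
sources: VishikFursikov1988, arXiv:1606.02174, arXiv:1411.3391, arXiv:math/0602612, doi:10.1137/130931631, doi:10.5802/aif.2836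
[crux] for f smooth div-free mean-zero and E, ε > 0 there is M = M(f, E, ε) (M = 4‖f‖₂²E²/ε² + 1
works) such that for every ν > 0, R, κ: if for infinitely many N there is a Galerkin-invariant
probability measure at level N (generator identity for every cylindrical test with band-limited
fields), supported in ‖u‖ ≤ R, with κ-resolved dissipation, mean energy ≤ E and dissipation ≥ ε,
then ONE global Leray–Hopf solution of NS_ν forced by f has limsup-mean energy ≤ M and limsup-mean
dissipation ≥ ε/2. Plan: stationary Galerkin laws are tight on C([0,∞);H_w) ∩ L²_loc(H); the
shift-invariant Vishik–Fursikov limit is carried by Leray–Hopf paths (the KNOWN Galerkin-limit case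
of Ensemble's EnsembleRealization); the tail clause passes the enstrophy of the time-0 marginal to
the limit (no leakage); Birkhoff on path space and Chebyshev against the pathwise bound ν⟨‖∇u‖²⟩ ≤
‖f‖₂⟨|u|²⟩^{1/2} select the path. [difficulty: L] -/
@[route_item "route-AnomalousDissipation-MomentParity", crux]
def GalerkinEnsembleRealization : Prop :=
  ∀ f : UnitAddTorus (Fin 3) → EuclideanSpace ℝ (Fin 3), Literature.Analysis.FunctionSpaces.Torus.IsSmooth f → Literature.Analysis.FunctionSpaces.Torus.IsDivFree f → Literature.Analysis.FunctionSpaces.Torus.HasZeroMean f → ∀ E ε : ℝ, 0 < ε → ∃ M : ℝ, ∀ ν : ℝ, 0 < ν → ∀ (R : ℝ) (κ : ℕ → ℕ), (∃ᶠ N in Filter.atTop, ∃ μ : MeasureTheory.Measure (Literature.Analysis.FunctionSpaces.Torus.energySpace (Fin 3)), MeasureTheory.IsProbabilityMeasure μ ∧ (∀ᵐ (u : Literature.Analysis.FunctionSpaces.Torus.energySpace (Fin 3)) ∂μ, (∀ k ∉ (Literature.Analysis.FunctionSpaces.Torus.freqBall N).erase (0 : Fin 3 → ℤ), UnitAddTorus.mFourierCoeff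 (Literature.Analysis.FunctionSpaces.EuclideanSpace.complexify ∘ (u.1 : UnitAddTorus (Fin 3) → EuclideanSpace ℝ (Fin 3))) k = 0)) ∧ (∀ᵐ u ∂μ, ‖u‖ ≤ R) ∧ (∀ n : ℕ, ∫⁻ (u : Literature.Analysis.FunctionSpaces.Torus.energySpace (Fin 3)), Literature.Analysis.FunctionSpaces.Torus.eGradNormSq (u.1 : UnitAddTorus (Fin 3) → EuclideanSpace ℝ (Fin 3)) ∂μ ≤ (∫⁻ (u : Literature.Analysis.FunctionSpaces.Torus.energySpace (Fin 3)), Literature.Analysis.FunctionSpaces.Torus.eGradNormSq (Literature.Analysis.FunctionSpaces.Torus.fourierTruncate (κ n) (u.1 : UnitAddTorus (Fin 3) → EuclideanSpace ℝ (Fin 3))) ∂μ) + ((n : ENNReal) + 1)⁻¹) ∧ (∀ Φ : Literature.Analysis.FluidPDE.Torus.CylindricalTest (Fin 3), (∀ i, (∀ k ∉ (Literature.Analysis.FunctionSpaces.Torus.freqBall N).erase (0 : Fin 3 → ℤ), UnitAddTorus.mFourierCoeff (Literature.Analysis.FunctionSpaces.EuclideanSpace.complexify ∘ (Φ.g i))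 k = 0)) → MeasureTheory.Integrable (fun u => Literature.Analysis.FluidPDE.Torus.nsGeneratorPairing ν f u (Φ.grad u)) μ ∧ ∫ u, Literature.Analysis.FluidPDE.Torus.nsGeneratorPairing ν f u (Φ.grad u) ∂μ = 0) ∧ Literature.Analysis.FluidPDE.Torus.ensembleEnergy μ ≤ E ∧ ε ≤ Literature.Analysis.FluidPDE.Torus.ensembleDissipation ν μ) → ∃ (u₀ : UnitAddTorus (Fin 3) → EuclideanSpace ℝ (Fin 3)) (u : ℝ → UnitAddTorus (Fin 3) → EuclideanSpace ℝ (Fin 3)), Literature.Analysis.FluidPDE.Torus.IsGlobalLerayHopf ν (fun _ => f) u₀ u ∧ Literature.Analysis.FluidPDE.meanEnergy u ≤ M ∧ ε / 2 ≤ Literature.Analysis.FluidPDE.meanDissipation ν u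

/-- item stmt-AnomalousDissipation-14283 · crux · rank 4 · open · by planner
why it might fail: The zeroth law for Galerkin-invariant ensembles: false iff for every force all bounded-energy level-N invariant families have (f,ū)→0 N-frequently as ν→0 (uniform depletion; in 2-D true quietness, Alexakis–Doering ε≲ν^{1/2}); Cheskidov arXiv:2311.04182 Thm 1.3 makes ∃f load-bearing.
sources: FMRTTurbulence2001, doi:10.1017/s0022112002001386, Kraichnan1973, KanedaEtAl2003, Cheskidov2023, AlexakisDoering2006PLA
[crux] The d = ∞ rung, i.e. X with `∀ d` moved inside and the resolution clause split off: for SOME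
smooth divergence-free mean-zero force f, viscosities ν_j → 0 and budgets E, ε > 0, at every j there
is a support radius R such that for infinitely many Galerkin levels N there is a Borel probability
measure on H carried by the level-N fields, supported in ‖u‖ ≤ R, STATIONARY for Galerkin NS at
(ν_j, f) against EVERY polynomial cylindrical observable with band-limited smooth solenoidal test
fields (all degrees — on compactly supported level-N measures this is flow-invariance, Liouville),
and LOUD: mean energy ≤ E, ν_j∫‖∇u‖²dμ ≥ ε. This is the zeroth law in its weakest finite-dimensional
form (Galerkin-invariant ensembles, e.g. Krylov–Bogoliubov time averages of the truncated dynamics,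
for which R = |f|/(4π²ν_j) is free and ν⟨‖∇u‖²⟩ = ⟨(f,u)⟩ = (f, ū) exactly, so loud ⟺ the mean flow
keeps an O(1) projection on the force at bounded energy). It implies QuarticGate (bounded support
gives the fourth moments) and, with ResolvedDissipation, the target MomentLadder by pure logic
(glue). Difficulty: XL — it is the converged-DNS zeroth law. -/
@[route_item "route-AnomalousDissipation-MomentParity", crux]
def GalerkinInvariantLoud : Prop :=
  ∃ f : UnitAddTorus (Fin 3) → EuclideanSpace ℝ (Fin 3), Literature.Analysis.FunctionSpaces.Torus.IsSmooth f ∧ Literature.Analysis.FunctionSpaces.Torus.IsDivFree f ∧ Literature.Analysis.FunctionSpaces.Torus.HasZeroMean f ∧ ∃ (ν : ℕ → ℝ) (E ε : ℝ), (∀ j, 0 < ν j) ∧ Filter.Tendsto ν Filter.atTop (nhds 0) ∧ 0 < ε ∧ ∀ j : ℕ, ∃ R : ℝ, ∃ᶠ N in Filter.atTop, ∃ μ : MeasureTheory.Measure (Literature.Analysis.FunctionSpaces.Torus.energySpace (Fin 3)), MeasureTheory.IsProbabilityMeasure μ ∧ (∀ᵐ (u : Literature.Analysis.FunctionSpaces.Torus.energySpace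 (Fin 3)) ∂μ, (∀ k ∉ (Literature.Analysis.FunctionSpaces.Torus.freqBall N).erase (0 : Fin 3 → ℤ), UnitAddTorus.mFourierCoeff (Literature.Analysis.FunctionSpaces.EuclideanSpace.complexify ∘ (u.1 : UnitAddTorus (Fin 3) → EuclideanSpace ℝ (Fin 3))) k = 0)) ∧ (∀ᵐ u ∂μ, ‖u‖ ≤ R) ∧ (∀ (m : ℕ) (g : Fin m → UnitAddTorus (Fin 3) → EuclideanSpace ℝ (Fin 3)) (P : MvPolynomial (Fin m) ℝ), (∀ i, (Literature.Analysis.FunctionSpaces.Torus.IsSmooth (g i) ∧ Literature.Analysis.FunctionSpaces.Torus.IsDivFree (g i) ∧ Literature.Analysis.FunctionSpaces.Torus.HasZeroMean (g i) ∧ (∀ k ∉ (Literature.Analysis.FunctionSpaces.Torus.freqBall N).erase (0 : Fin 3 → ℤ), UnitAddTorus.mFourierCoeff (Literature.Analysis.FunctionSpaces.EuclideanSpace.complexify ∘ (g i)) k = 0))) → MeasureTheory.Integrable (fun u => Literature.Analysis.FluidPDE.Torus.nsGeneratorPairing (ν j) f u (fun x => ∑ i : Fin m, (MvPolynomial.eval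 (fun j => Literature.Analysis.FluidPDE.Torus.pairing u.1 (g j)) (MvPolynomial.pderiv i P)) • g i x)) μ ∧ ∫ u, Literature.Analysis.FluidPDE.Torus.nsGeneratorPairing (ν j) f u (fun x => ∑ i : Fin m, (MvPolynomial.eval (fun j => Literature.Analysis.FluidPDE.Torus.pairing u.1 (g j)) (MvPolynomial.pderiv i P)) • g i x) ∂μ = 0) ∧ Literature.Analysis.FluidPDE.Torus.ensembleEnergy μ ≤ E ∧ ε ≤ Literature.Analysis.FluidPDE.Torus.ensembleDissipation (ν j) μ

/-- item stmt-AnomalousDissipation-14284 · crux · rank 5 · open · by planner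
why it might fail: Forces the mean energy EQUALITY for every Galerkin-limit stationary statistical solution at fixed ν (3-D: only FMRT IV (1.31) ≤ known); N-uniform control stops at ⟨‖∇u‖²⟩ and ⟨|Au|^{2/3}⟩, so an intermittent ensemble could park O(1) enstrophy at the cutoff shell as N→∞.
sources: FMRTTurbulence2001, FoiasGuillopeTemam1981, arXiv:0704.0759, BronziMondainiRosa2014, arXiv:1606.02174, Literature.Analysis.FluidPDE.StatisticalSolutionEnergyEq
[crux] No enstrophy leakage at FIXED viscosity: for every smooth divergence-free mean-zero f, every
ν > 0 and every radius R there is ONE resolution schedule κ : ℕ → ℕ such that for EVERY Galerkin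
level N and EVERY Borel probability measure on H carried by level-N fields, supported in ‖u‖ ≤ R and
stationary for Galerkin NS at (ν, f) against all polynomial cylindrical band-limited observables,
the mean enstrophy is κ-resolved: ∫‖∇u‖²dμ ≤ ∫‖∇P_{κ(n)}u‖²dμ + 1/(n+1) for all n. Equivalently (up
to subsequences): weak limits N → ∞ of such invariant families — Vishik–Fursikov/FMRT stationary
statistical solutions — satisfy the mean energy EQUALITY ν⟨‖∇u‖²⟩ = ⟨(f,u)⟩ rather than FMRT's
inequality (IV (1.31)); physically the dissipation spectrum is cut off at k_η(ν) uniformly in the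
truncation. Known N-uniform input: ν⟨‖∇u‖²⟩ = ⟨(f,u)⟩ ≤ |f|R at each N, ⟨|Au|^{2/3}⟩ ≤ c
(Foias–Guillopé–Temam, FMRT IV (3.6)); Dirac measures at steady states satisfy it (elliptic
bootstrap gives ‖Au_N‖ ≤ C(ν,R,f)). This is the clause that makes GalerkinEnsembleRealization
lossless; it is a fixed-ν, regularity-flavoured statement independent of the ν → 0 question.
Difficulty: L. Tree pointer: the d = 2 analogu -/
@[route_item "route-AnomalousDissipation-MomentParity", crux]
def ResolvedDissipation : Prop :=
  ∀ f : UnitAddTorus (Fin 3) → EuclideanSpace ℝ (Fin 3), Literature.Analysis.FunctionSpaces.Torus.IsSmooth f → Literature.Analysis.FunctionSpaces.Torus.IsDivFree f → Literature.Analysis.FunctionSpaces.Torus.HasZeroMean f → ∀ ν : ℝ, 0 < ν → ∀ R : ℝ, ∃ κ : ℕ → ℕ, ∀ (N : ℕ) (μ : MeasureTheory.Measure (Literature.Analysis.FunctionSpaces.Torus.energySpace (Fin 3))), MeasureTheory.IsProbabilityMeasure μ → (∀ᵐ (u : Literature.Analysis.FunctionSpaces.Torus.energySpace (Fin 3)) ∂μ,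 (∀ k ∉ (Literature.Analysis.FunctionSpaces.Torus.freqBall N).erase (0 : Fin 3 → ℤ), UnitAddTorus.mFourierCoeff (Literature.Analysis.FunctionSpaces.EuclideanSpace.complexify ∘ (u.1 : UnitAddTorus (Fin 3) → EuclideanSpace ℝ (Fin 3))) k = 0)) → (∀ᵐ u ∂μ, ‖u‖ ≤ R) → (∀ (m : ℕ) (g : Fin m → UnitAddTorus (Fin 3) → EuclideanSpace ℝ (Fin 3)) (P : MvPolynomial (Fin m) ℝ), (∀ i, (Literature.Analysis.FunctionSpaces.Torus.IsSmooth (g i) ∧ Literature.Analysis.FunctionSpaces.Torus.IsDivFree (g i) ∧ Literature.Analysis.FunctionSpaces.Torus.HasZeroMean (g i) ∧ (∀ k ∉ (Literature.Analysis.FunctionSpaces.Torus.freqBall N).erase (0 : Fin 3 → ℤ), UnitAddTorus.mFourierCoeff (Literature.Analysis.FunctionSpaces.EuclideanSpace.complexify ∘ (g i)) k = 0))) → MeasureTheory.Integrable (fun u => Literature.Analysis.FluidPDE.Torus.nsGeneratorPairing ν f u (fun x => ∑ i : Fin m, (MvPolynomial.eval (fun j => Literature.Analysis.FluidPDE.Torus.pairing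 u.1 (g j)) (MvPolynomial.pderiv i P)) • g i x)) μ ∧ ∫ u, Literature.Analysis.FluidPDE.Torus.nsGeneratorPairing ν f u (fun x => ∑ i : Fin m, (MvPolynomial.eval (fun j => Literature.Analysis.FluidPDE.Torus.pairing u.1 (g j)) (MvPolynomial.pderiv i P)) • g i x) ∂μ = 0) → ∀ n : ℕ, ∫⁻ (u : Literature.Analysis.FunctionSpaces.Torus.energySpace (Fin 3)), Literature.Analysis.FunctionSpaces.Torus.eGradNormSq (u.1 : UnitAddTorus (Fin 3) → EuclideanSpace ℝ (Fin 3)) ∂μ ≤ (∫⁻ (u : Literature.Analysis.FunctionSpaces.Torus.energySpace (Fin 3)), Literature.Analysis.FunctionSpaces.Torus.eGradNormSq (Literature.Analysis.FunctionSpaces.Torus.fourierTruncate (κ n) (u.1 : UnitAddTorus (Fin 3) → EuclideanSpace ℝ (Fin 3))) ∂μ) + ((n : ENNReal) + 1)⁻¹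

/-- item stmt-AnomalousDissipation-11464 · support · rank 2 · closed · proved by Summit.AnomalousDissipation.AnomalousDissipation.Theorems.quarticGate_momentParity_proof @ 559b400392b1 (prover) · by planner
why it might fail: False iff for each force a cubic auxiliary functional + nonneg quartic certify ν⟨‖∇u‖²⟩<ε on {⟨|u|²⟩≤E} for Galerkin NS uniformly in N as ν→0 (moment/SOS duality): open both ways; order 4 is where quasi-normal closure lost realizability (Ogura, Orszag, Betchov); M(2)≻0 gives no measure in ≥3 vars.
sources: doi:10.1016/j.physleta.2017.12.023, arXiv:1512.05599, arXiv:1807.08956, doi:10.1017/s0022112063000562, doi:10.1017/s0022112070000642, doi:10.1017/s0022112056000317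
[crux] card K1 = PZL₄: ∃ f smooth div-free mean-zero, ν_j → 0, E, ε > 0 such that at every j, for
infinitely many N, a probability measure on H carried by level-N fields, with finite fourth moments,
is 4-STATIONARY (every polynomial observable of degree ≤ 3 drift-free: mean-flow balance, all
two-point AND all three-point budgets of Galerkin NS close exactly) with mean energy ≤ E and
dissipation ν_j∫‖∇u‖² ≥ ε. Necessary for MomentLadder (its d = 4 rung minus the support/tail
clauses) and the first rung where positivity bites: fourth cumulants must cancel the Wick
contribution to every third-moment budget to relative accuracy ≍ Re_λ⁻¹ while the degree-4 moment
matrix stays PSD — the stationary form of the quasi-normal inconsistency; a realizable, exactly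
budget-consistent fourth-order pseudo-statistics of forced NS at Re → ∞. [deps: CubicParityLoud]
[difficulty: XL] -/
@[route_item "route-AnomalousDissipation-MomentParity"]
def QuarticGate : Prop :=
  ∃ f : UnitAddTorus (Fin 3) → EuclideanSpace ℝ (Fin 3), Literature.Analysis.FunctionSpaces.Torus.IsSmooth f ∧ Literature.Analysis.FunctionSpaces.Torus.IsDivFree f ∧ Literature.Analysis.FunctionSpaces.Torus.HasZeroMean f ∧ ∃ (ν : ℕ → ℝ) (E ε : ℝ), (∀ j, 0 < ν j) ∧ Filter.Tendsto ν Filter.atTop (nhds 0) ∧ 0 < ε ∧ ∀ j : ℕ, ∃ᶠ N in Filter.atTop, ∃ μ : MeasureTheory.Measure (Literature.Analysis.FunctionSpaces.Torus.energySpace (Fin 3)), MeasureTheory.IsProbabilityMeasure μ ∧ (∀ᵐ (u : Literature.Analysis.FunctionSpaces.Torus.energySpace (Fin 3)) ∂μ, (∀ k ∉ (Literature.Analysis.FunctionSpaces.Torus.freqBall N).erase (0 : Fin 3 → ℤ), UnitAddTorus.mFourierCoeff (Literature.Analysis.FunctionSpaces.EuclideanSpace.complexify ∘ (u.1 : UnitAddTorus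 (Fin 3) → EuclideanSpace ℝ (Fin 3))) k = 0)) ∧ MeasureTheory.Integrable (fun u => ‖u‖ ^ 4) μ ∧ (∀ (m : ℕ) (g : Fin m → UnitAddTorus (Fin 3) → EuclideanSpace ℝ (Fin 3)) (P : MvPolynomial (Fin m) ℝ), (∀ i, (Literature.Analysis.FunctionSpaces.Torus.IsSmooth (g i) ∧ Literature.Analysis.FunctionSpaces.Torus.IsDivFree (g i) ∧ Literature.Analysis.FunctionSpaces.Torus.HasZeroMean (g i) ∧ (∀ k ∉ (Literature.Analysis.FunctionSpaces.Torus.freqBall N).erase (0 : Fin 3 → ℤ), UnitAddTorus.mFourierCoeff (Literature.Analysis.FunctionSpaces.EuclideanSpace.complexify ∘ (g i)) k = 0))) → P.totalDegree + 1 ≤ 4 → MeasureTheory.Integrable (fun u => Literature.Analysis.FluidPDE.Torus.nsGeneratorPairing (ν j) f u (fun x => ∑ i : Fin m, (MvPolynomial.eval (fun j => Literature.Analysis.FluidPDE.Torus.pairing u.1 (g j)) (MvPolynomial.pderiv i P)) • g i x)) μ ∧ ∫ u, Literature.Analysis.FluidPDE.Torus.nsGeneratorPairing (ν j) f u (fun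 x => ∑ i : Fin m, (MvPolynomial.eval (fun j => Literature.Analysis.FluidPDE.Torus.pairing u.1 (g j)) (MvPolynomial.pderiv i P)) • g i x) ∂μ = 0) ∧ Literature.Analysis.FluidPDE.Torus.ensembleEnergy μ ≤ E ∧ ε ≤ Literature.Analysis.FluidPDE.Torus.ensembleDissipation (ν j) μ

/-- item stmt-AnomalousDissipation-11465 · support · rank 3 · open · by planner
why it might fail: Rests on two unproved all-N facts on truncated Euler: quadratic null space of ⟨∇Q,P_N B(u,u)⟩≡0 is span{E,H} (numerics ≤728 modes only; odd truncation shapes may add invariants) and the stress cone {P_N B(v,v)} fills V_N; then exact energy+helicity budgets, energy ≤E at N≍ν^{-1/2}, for EVERY f≠0.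
sources: doi:10.1017/s0022112073001837, doi:10.1073/pnas.1516213113, arXiv:0908.3230, doi:10.1016/j.physleta.2006.07.048, arXiv:2311.04182, book:dwoyer1985-theoretical-approaches-turbulence p.219
[crux] card T3/P2: for EVERY smooth div-free mean-zero f ≠ 0 there are E, ε, ν₀ > 0 such that for
all ν ∈ (0, ν₀) and all N ≥ N₀(ν) (N₀ ≍ ν^{-1/2}, the Taylor wavenumber) a probability measure on H
carried by level-N fields, with finite third moments, is 3-STATIONARY (all linear and quadratic
observables drift-free) with mean energy ≤ E and dissipation ≥ ε. Parity: odd-order realizability is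
vacuous once the covariance is definite (Gaussian ⊕ sparse far atoms realise any third-moment
tensor), so order 3 is linear algebra with range (quadratic invariants of Galerkin Euler)^⊥ = {E,
H}^⊥: energy ⇔ ε = (f, ū) (mean flow), helicity ⇔ chirality of the Taylor-shell sea (H indefinite).
Corollary by one integration: no argument using stationarity only through budgets of observables of
degree ≤ 2 (energy, enstrophy, helicity, mean/fluctuation splits, Kármán–Howarth–Monin) bounds 3-D
dissipation by o(1) — the quadratic tier of route Neg is void. [difficulty: M] -/
@[route_item "route-AnomalousDissipation-MomentParity"]
def CubicParityLoud : Prop :=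
  ∀ f : UnitAddTorus (Fin 3) → EuclideanSpace ℝ (Fin 3), Literature.Analysis.FunctionSpaces.Torus.IsSmooth f → Literature.Analysis.FunctionSpaces.Torus.IsDivFree f → Literature.Analysis.FunctionSpaces.Torus.HasZeroMean f → f ≠ 0 → ∃ E ε ν₀ : ℝ, 0 < ε ∧ 0 < ν₀ ∧ ∀ ν : ℝ, 0 < ν → ν < ν₀ → ∃ N₀ : ℕ, ∀ N : ℕ, N₀ ≤ N → ∃ μ : MeasureTheory.Measure (Literature.Analysis.FunctionSpaces.Torus.energySpace (Fin 3)), MeasureTheory.IsProbabilityMeasure μ ∧ (∀ᵐ (u : Literature.Analysis.FunctionSpaces.Torus.energySpace (Fin 3)) ∂μ, (∀ k ∉ (Literature.Analysis.FunctionSpaces.Torus.freqBall N).erase (0 : Fin 3 → ℤ), UnitAddTorus.mFourierCoeff (Literature.Analysis.FunctionSpaces.EuclideanSpace.complexify ∘ (u.1 : UnitAddTorus (Fin 3) → EuclideanSpace ℝ (Fin 3))) k = 0)) ∧ MeasureTheory.Integrable (fun u => ‖u‖ ^ 3) μ ∧ (∀ (m : ℕ) (g : Fin m → UnitAddTorus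 (Fin 3) → EuclideanSpace ℝ (Fin 3)) (P : MvPolynomial (Fin m) ℝ), (∀ i, (Literature.Analysis.FunctionSpaces.Torus.IsSmooth (g i) ∧ Literature.Analysis.FunctionSpaces.Torus.IsDivFree (g i) ∧ Literature.Analysis.FunctionSpaces.Torus.HasZeroMean (g i) ∧ (∀ k ∉ (Literature.Analysis.FunctionSpaces.Torus.freqBall N).erase (0 : Fin 3 → ℤ), UnitAddTorus.mFourierCoeff (Literature.Analysis.FunctionSpaces.EuclideanSpace.complexify ∘ (g i)) k = 0))) → P.totalDegree + 1 ≤ 3 → MeasureTheory.Integrable (fun u => Literature.Analysis.FluidPDE.Torus.nsGeneratorPairing ν f u (fun x => ∑ i : Fin m, (MvPolynomial.eval (fun j => Literature.Analysis.FluidPDE.Torus.pairing u.1 (g j)) (MvPolynomial.pderiv i P)) • g i x)) μ ∧ ∫ u, Literature.Analysis.FluidPDE.Torus.nsGeneratorPairing ν f u (fun x => ∑ i : Fin m, (MvPolynomial.eval (fun j => Literature.Analysis.FluidPDE.Torus.pairing u.1 (g j)) (MvPolynomial.pderiv i P)) • g i x) ∂μ = 0) ∧ Literature.Analysis.FluidPDE.Torus.ensembleEnergy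 μ ≤ E ∧ ε ≤ Literature.Analysis.FluidPDE.Torus.ensembleDissipation ν μ

/-- item stmt-AnomalousDissipation-14330 · support · rank 4 · open · by planner
why it might fail: 3-D stationary statistical solutions carry only the mean energy INEQUALITY (FMRT2001 Def IV.1.3 (1.31)); N-uniform integrability of enstrophy under invariant Galerkin laws is open (≈ energy equality) — a loud ensemble thermalising at the cutoff (doi:10.1103/physrevlett.95.264502) refutes it.
sources: FMRT2001, arXiv:1606.02174, doi:10.1103/physrevlett.95.264502, doi:10.1137/130931631, arXiv:1411.3391, VishikFursikov1988
[crux] N-UNIFORM RESOLUTION at fixed viscosity: for every smooth div-free mean-zero f, ν_j → 0 and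
E, ε > 0 — if at every j there is R such that for infinitely many N and every order d a level-N
probability measure supported in ‖u‖ ≤ R is d-stationary for Galerkin NS at (ν_j, P_N f) with mean
energy ≤ E and dissipation ≥ ε (by MomentClosure: a loud Galerkin-invariant measure at infinitely
many levels), then for some budgets E′, ε′ > 0 the same holds TOGETHER WITH a resolution schedule
κ_j uniform in N: ∫‖∇u‖²dμ ≤ ∫‖∇P_{κ(n)}u‖²dμ + 1/(n+1) for all n (the full MomentLadder body,
verbatim). Content: loud stationary Galerkin ensembles at fixed ν do not leak a fixed fraction of
their dissipation to the truncation scale as N → ∞ (dissipation spectrum tight in k uniformly in N,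
physically cut off at k_η(ν)); equivalently the Galerkin-limit Foias–Prodi stationary statistical
solution satisfies the mean energy EQUALITY ν⟨‖∇u‖²⟩ = ⟨(f,u)⟩ along the loud subsequence; the
invariant measure may be changed level by level (ergodic components, time averages). The κ-content
of X flagged by the 2026-08-15 retriage, made its own item; 2-D and hyperviscous analogues are
theorems. [deps: MomentClosure -/
@[route_item "route-AnomalousDissipation-MomentParity"]
def UniformResolution : Prop :=
  ∀ f : UnitAddTorus (Fin 3) → EuclideanSpace ℝ (Fin 3), Literature.Analysis.FunctionSpaces.Torus.IsSmooth f → Literature.Analysis.FunctionSpaces.Torus.IsDivFree f → Literature.Analysis.FunctionSpaces.Torus.HasZeroMean f → ∀ (ν : ℕ → ℝ) (E ε : ℝ), (∀ j, 0 < ν j) → Filter.Tendsto ν Filter.atTop (nhds 0) → 0 < ε → (∀ j : ℕ, ∃ R : ℝ, ∃ᶠ N in Filter.atTop, ∀ d : ℕ, ∃ μ : MeasureTheory.Measure (Literature.Analysis.FunctionSpaces.Torus.energySpace (Fin 3)), MeasureTheory.IsProbabilityMeasure μ ∧ (∀ᵐ u ∂μ, (∀ k ∉ (Literature.Analysis.FunctionSpaces.Torus.freqBall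 N).erase (0 : Fin 3 → ℤ), UnitAddTorus.mFourierCoeff (Literature.Analysis.FunctionSpaces.EuclideanSpace.complexify ∘ (u.1 : UnitAddTorus (Fin 3) → EuclideanSpace ℝ (Fin 3))) k = 0)) ∧ (∀ᵐ u ∂μ, ‖u‖ ≤ R) ∧ (∀ (m : ℕ) (g : Fin m → UnitAddTorus (Fin 3) → EuclideanSpace ℝ (Fin 3)) (P : MvPolynomial (Fin m) ℝ), (∀ i, (Literature.Analysis.FunctionSpaces.Torus.IsSmooth (g i) ∧ Literature.Analysis.FunctionSpaces.Torus.IsDivFree (g i) ∧ Literature.Analysis.FunctionSpaces.Torus.HasZeroMean (g i) ∧ (∀ k ∉ (Literature.Analysis.FunctionSpaces.Torus.freqBall N).erase (0 : Fin 3 → ℤ), UnitAddTorus.mFourierCoeff (Literature.Analysis.FunctionSpaces.EuclideanSpace.complexify ∘ (g i)) k = 0))) → P.totalDegree + 1 ≤ d → MeasureTheory.Integrable (fun u => Literature.Analysis.FluidPDE.Torus.nsGeneratorPairing (ν j) f u (fun x => ∑ i : Fin m, (MvPolynomial.eval (fun j => Literature.Analysis.FluidPDE.Torus.pairing u.1 (g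 j)) (MvPolynomial.pderiv i P)) • g i x)) μ ∧ ∫ u, Literature.Analysis.FluidPDE.Torus.nsGeneratorPairing (ν j) f u (fun x => ∑ i : Fin m, (MvPolynomial.eval (fun j => Literature.Analysis.FluidPDE.Torus.pairing u.1 (g j)) (MvPolynomial.pderiv i P)) • g i x) ∂μ = 0) ∧ Literature.Analysis.FluidPDE.Torus.ensembleEnergy μ ≤ E ∧ ε ≤ Literature.Analysis.FluidPDE.Torus.ensembleDissipation (ν j) μ) → ∃ E' ε' : ℝ, 0 < ε' ∧ ∀ j : ℕ, ∃ (R : ℝ) (κ : ℕ → ℕ), ∃ᶠ N in Filter.atTop, ∀ d : ℕ, ∃ μ : MeasureTheory.Measure (Literature.Analysis.FunctionSpaces.Torus.energySpace (Fin 3)), MeasureTheory.IsProbabilityMeasure μ ∧ (∀ᵐ u ∂μ, (∀ k ∉ (Literature.Analysis.FunctionSpaces.Torus.freqBall N).erase (0 : Fin 3 → ℤ), UnitAddTorus.mFourierCoeff (Literature.Analysis.FunctionSpaces.EuclideanSpace.complexify ∘ (u.1 : UnitAddTorus (Fin 3) → EuclideanSpace ℝ (Fin 3))) k = 0)) ∧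 (∀ᵐ u ∂μ, ‖u‖ ≤ R) ∧ (∀ n : ℕ, ∫⁻ u, Literature.Analysis.FunctionSpaces.Torus.eGradNormSq (u.1 : UnitAddTorus (Fin 3) → EuclideanSpace ℝ (Fin 3)) ∂μ ≤ (∫⁻ u, Literature.Analysis.FunctionSpaces.Torus.eGradNormSq (Literature.Analysis.FunctionSpaces.Torus.fourierTruncate (κ n) (u.1 : UnitAddTorus (Fin 3) → EuclideanSpace ℝ (Fin 3))) ∂μ) + ((n : ENNReal) + 1)⁻¹) ∧ (∀ (m : ℕ) (g : Fin m → UnitAddTorus (Fin 3) → EuclideanSpace ℝ (Fin 3)) (P : MvPolynomial (Fin m) ℝ), (∀ i, (Literature.Analysis.FunctionSpaces.Torus.IsSmooth (g i) ∧ Literature.Analysis.FunctionSpaces.Torus.IsDivFree (g i) ∧ Literature.Analysis.FunctionSpaces.Torus.HasZeroMean (g i) ∧ (∀ k ∉ (Literature.Analysis.FunctionSpaces.Torus.freqBall N).erase (0 : Fin 3 → ℤ), UnitAddTorus.mFourierCoeff (Literature.Analysis.FunctionSpaces.EuclideanSpace.complexify ∘ (g i)) k = 0))) → P.totalDegree +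 1 ≤ d → MeasureTheory.Integrable (fun u => Literature.Analysis.FluidPDE.Torus.nsGeneratorPairing (ν j) f u (fun x => ∑ i : Fin m, (MvPolynomial.eval (fun j => Literature.Analysis.FluidPDE.Torus.pairing u.1 (g j)) (MvPolynomial.pderiv i P)) • g i x)) μ ∧ ∫ u, Literature.Analysis.FluidPDE.Torus.nsGeneratorPairing (ν j) f u (fun x => ∑ i : Fin m, (MvPolynomial.eval (fun j => Literature.Analysis.FluidPDE.Torus.pairing u.1 (g j)) (MvPolynomial.pderiv i P)) • g i x) ∂μ = 0) ∧ Literature.Analysis.FluidPDE.Torus.ensembleEnergy μ ≤ E' ∧ ε' ≤ Literature.Analysis.FluidPDE.Torus.ensembleDissipation (ν j) μ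

/-- item stmt-AnomalousDissipation-14331 · support · rank 5 · open · by planner
why it might fail: Finite-order moment relaxations are generically strict: the invariant-measure hierarchy converges only as degree → ∞ (arXiv:1807.08956), optimal bounds need ALL test functionals (arXiv:2606.12825) — order-4 pseudo-ensembles may be loud while every invariant Galerkin law laminarises as ν → 0.
sources: arXiv:1807.08956, doi:10.1016/j.physleta.2017.12.023, arXiv:2010.06730, arXiv:2606.12825, doi:10.1007/s00332-017-9421-2, doi:10.1088/1361-6544/ab018b
[crux] ORDER-4 TIGHTNESS along ν_j → 0: for every smooth div-free mean-zero f, ν_j → 0 and E, ε > 0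
— if at every j, for infinitely many N, a level-N probability measure with finite fourth moments is
4-stationary for Galerkin NS at (ν_j, P_N f) with mean energy ≤ E and dissipation ≥ ε (the
QuarticGate body, verbatim), then for some budgets E′, ε′ > 0, at every j there is R such that for
infinitely many N and EVERY order d a level-N probability measure supported in ‖u‖ ≤ R is
d-stationary with mean energy ≤ E′ and dissipation ≥ ε′ (the MomentLadder body minus the resolution
clause, verbatim). Reading (via MomentClosure and the absorbing ball): loud order-4 pseudo-ensembles
⇒ loud Galerkin-INVARIANT ensembles along the same ν_j — the order-4 moment relaxation of "max
dissipation over invariant measures of level-N Galerkin NS at mean energy ≤ E" is tight up to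
constants, N-uniformly as ν → 0; dually (moment–SOS / minimax duality, arXiv:2010.06730,
arXiv:2606.12825), whenever Galerkin ensembles laminarise a CUBIC test functional already certifies
it. The climbing step d = 4 ⇒ all d of the ladder, filed top-level so that the cruxes reach the
target through LadderGlue. [deps: QuarticGate -/
@[route_item "route-AnomalousDissipation-MomentParity"]
def QuarticTightness : Prop :=
  ∀ f : UnitAddTorus (Fin 3) → EuclideanSpace ℝ (Fin 3), Literature.Analysis.FunctionSpaces.Torus.IsSmooth f → Literature.Analysis.FunctionSpaces.Torus.IsDivFree f → Literature.Analysis.FunctionSpaces.Torus.HasZeroMean f → ∀ (ν : ℕ → ℝ) (E ε : ℝ), (∀ j, 0 < ν j) → Filter.Tendsto ν Filter.atTop (nhds 0) → 0 < ε → (∀ j : ℕ, ∃ᶠ N in Filter.atTop, ∃ μ : MeasureTheory.Measure (Literature.Analysis.FunctionSpaces.Torus.energySpace (Fin 3)), MeasureTheory.IsProbabilityMeasure μ ∧ (∀ᵐ u ∂μ, (∀ k ∉ (Literature.Analysis.FunctionSpaces.Torus.freqBall N).erase (0 : Fin 3 → ℤ), UnitAddTorus.mFourierCoeff (Literature.Analysis.FunctionSpaces.EuclideanSpace.complexify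 ∘ (u.1 : UnitAddTorus (Fin 3) → EuclideanSpace ℝ (Fin 3))) k = 0)) ∧ MeasureTheory.Integrable (fun u => ‖u‖ ^ 4) μ ∧ (∀ (m : ℕ) (g : Fin m → UnitAddTorus (Fin 3) → EuclideanSpace ℝ (Fin 3)) (P : MvPolynomial (Fin m) ℝ), (∀ i, (Literature.Analysis.FunctionSpaces.Torus.IsSmooth (g i) ∧ Literature.Analysis.FunctionSpaces.Torus.IsDivFree (g i) ∧ Literature.Analysis.FunctionSpaces.Torus.HasZeroMean (g i) ∧ (∀ k ∉ (Literature.Analysis.FunctionSpaces.Torus.freqBall N).erase (0 : Fin 3 → ℤ), UnitAddTorus.mFourierCoeff (Literature.Analysis.FunctionSpaces.EuclideanSpace.complexify ∘ (g i)) k = 0))) → P.totalDegree + 1 ≤ 4 → MeasureTheory.Integrable (fun u => Literature.Analysis.FluidPDE.Torus.nsGeneratorPairing (ν j) f u (fun x => ∑ i : Fin m, (MvPolynomial.eval (fun j => Literature.Analysis.FluidPDE.Torus.pairing u.1 (g j)) (MvPolynomial.pderiv i P)) • g i x)) μ ∧ ∫ u, Literature.Analysis.FluidPDE.Torus.nsGeneratorPairing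 (ν j) f u (fun x => ∑ i : Fin m, (MvPolynomial.eval (fun j => Literature.Analysis.FluidPDE.Torus.pairing u.1 (g j)) (MvPolynomial.pderiv i P)) • g i x) ∂μ = 0) ∧ Literature.Analysis.FluidPDE.Torus.ensembleEnergy μ ≤ E ∧ ε ≤ Literature.Analysis.FluidPDE.Torus.ensembleDissipation (ν j) μ) → ∃ E' ε' : ℝ, 0 < ε' ∧ ∀ j : ℕ, ∃ R : ℝ, ∃ᶠ N in Filter.atTop, ∀ d : ℕ, ∃ μ : MeasureTheory.Measure (Literature.Analysis.FunctionSpaces.Torus.energySpace (Fin 3)), MeasureTheory.IsProbabilityMeasure μ ∧ (∀ᵐ u ∂μ, (∀ k ∉ (Literature.Analysis.FunctionSpaces.Torus.freqBall N).erase (0 : Fin 3 → ℤ), UnitAddTorus.mFourierCoeff (Literature.Analysis.FunctionSpaces.EuclideanSpace.complexify ∘ (u.1 : UnitAddTorus (Fin 3) → EuclideanSpace ℝ (Fin 3))) k = 0)) ∧ (∀ᵐ u ∂μ, ‖u‖ ≤ R) ∧ (∀ (m : ℕ) (g : Fin m → UnitAddTorus (Fin 3) → EuclideanSpace ℝ (Fin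 3)) (P : MvPolynomial (Fin m) ℝ), (∀ i, (Literature.Analysis.FunctionSpaces.Torus.IsSmooth (g i) ∧ Literature.Analysis.FunctionSpaces.Torus.IsDivFree (g i) ∧ Literature.Analysis.FunctionSpaces.Torus.HasZeroMean (g i) ∧ (∀ k ∉ (Literature.Analysis.FunctionSpaces.Torus.freqBall N).erase (0 : Fin 3 → ℤ), UnitAddTorus.mFourierCoeff (Literature.Analysis.FunctionSpaces.EuclideanSpace.complexify ∘ (g i)) k = 0))) → P.totalDegree + 1 ≤ d → MeasureTheory.Integrable (fun u => Literature.Analysis.FluidPDE.Torus.nsGeneratorPairing (ν j) f u (fun x => ∑ i : Fin m, (MvPolynomial.eval (fun j => Literature.Analysis.FluidPDE.Torus.pairing u.1 (g j)) (MvPolynomial.pderiv i P)) • g i x)) μ ∧ ∫ u, Literature.Analysis.FluidPDE.Torus.nsGeneratorPairing (ν j) f u (fun x => ∑ i : Fin m, (MvPolynomial.eval (fun j => Literature.Analysis.FluidPDE.Torus.pairing u.1 (g j)) (MvPolynomial.pderiv i P)) • g i x) ∂μ = 0) ∧ Literature.Analysis.FluidPDE.Torus.ensembleEnergy μ ≤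 E' ∧ ε' ≤ Literature.Analysis.FluidPDE.Torus.ensembleDissipation (ν j) μ

/-- item stmt-AnomalousDissipation-14840 · support · rank 6 · open · by planner
why it might fail: A cubic Casimir of the ball truncation surviving at all large N (NoCubicCasimir checked only for 0<|k|²≤3) leaves an order-4 row no far atom can move; or a 3-loud law on the boundary of the moment cone (no Slater point) blocks exact re-absorption of the O(1/R) drift of the lower rows.
sources: doi:10.1090/s0002-9939-06-08249-9, arXiv:0908.3230, doi:10.1090/memo/0568, doi:10.1017/s0022112073001837, arXiv:1807.08956, doi:10.3934/dcdsb.2019165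
[crux] THE CLIMBING STEP d = 3 → 4 along ν_j → 0 (order-3 loudness already passes the typed quartic
gate): for every smooth div-free mean-zero f, every ν_j → 0 (ν_j > 0) and E, ε > 0 — IF at every j,
for infinitely many N, a level-N probability measure with finite third moments is 3-STATIONARY for
Galerkin NS at (ν_j, P_N f) (all linear and quadratic observables drift-free) with mean energy ≤ E
and dissipation ≥ ε (the CubicParityLoud body along the sequence, verbatim), THEN for some budgets
E′, ε′ > 0, at every j, for infinitely many N, a level-N probability measure with finite fourth
moments is 4-STATIONARY with mean energy ≤ E′ and dissipation ≥ ε′ (the QuarticGate body, verbatim).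
Force- and design-independent mechanism: (1) TAIL EXCHANGE — Tchakaloff/Bayer–Teichmann
(doi:10.1090/s0002-9939-06-08249-9) replaces the restriction of the given law to {‖u‖ > R} by
finitely many atoms out there with the same integrals against all polynomials of degree ≤ 3 on V_N,
so 3-stationarity, energy and dissipation are kept EXACTLY and the support becomes bounded (all
moments finite); (2) FAR-ATOM ORDER-4 SURGERY — antipodal atom pairs at radius R with weight ≍ R⁻⁴
move the quartic (Euler) part -/
@[route_item "route-AnomalousDissipation-MomentParity"]
def CubicClimb : Prop :=
  ∀ f : UnitAddTorus (Fin 3) → EuclideanSpace ℝ (Fin 3), Literature.Analysis.FunctionSpaces.Torus.IsSmooth f → Literature.Analysis.FunctionSpaces.Torus.IsDivFree f → Literature.Analysis.FunctionSpaces.Torus.HasZeroMean f → ∀ (ν : ℕ → ℝ) (E ε : ℝ), (∀ j, 0 < ν j) → Filter.Tendsto ν Filter.atTop (nhds 0) → 0 < ε → (∀ j : ℕ, ∃ᶠ N in Filter.atTop, ∃ μ : MeasureTheory.Measure (Literature.Analysis.FunctionSpaces.Torus.energySpace (Fin 3)), MeasureTheory.IsProbabilityMeasure μ ∧ (∀ᵐ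 (u : Literature.Analysis.FunctionSpaces.Torus.energySpace (Fin 3)) ∂μ, (∀ k ∉ (Literature.Analysis.FunctionSpaces.Torus.freqBall N).erase (0 : Fin 3 → ℤ), UnitAddTorus.mFourierCoeff (Literature.Analysis.FunctionSpaces.EuclideanSpace.complexify ∘ (u.1 : UnitAddTorus (Fin 3) → EuclideanSpace ℝ (Fin 3))) k = 0)) ∧ MeasureTheory.Integrable (fun u => ‖u‖ ^ 3) μ ∧ (∀ (m : ℕ) (g : Fin m → UnitAddTorus (Fin 3) → EuclideanSpace ℝ (Fin 3)) (P : MvPolynomial (Fin m) ℝ), (∀ i, (Literature.Analysis.FunctionSpaces.Torus.IsSmooth (g i) ∧ Literature.Analysis.FunctionSpaces.Torus.IsDivFree (g i) ∧ Literature.Analysis.FunctionSpaces.Torus.HasZeroMean (g i) ∧ (∀ k ∉ (Literature.Analysis.FunctionSpaces.Torus.freqBall N).erase (0 : Fin 3 → ℤ), UnitAddTorus.mFourierCoeff (Literature.Analysis.FunctionSpaces.EuclideanSpace.complexify ∘ (g i)) k = 0))) → P.totalDegree + 1 ≤ 3 → MeasureTheory.Integrable (fun u => Literature.Analysis.FluidPDE.Torus.nsGeneratorPairing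 (ν j) f u (fun x => ∑ i : Fin m, (MvPolynomial.eval (fun j => Literature.Analysis.FluidPDE.Torus.pairing u.1 (g j)) (MvPolynomial.pderiv i P)) • g i x)) μ ∧ ∫ u, Literature.Analysis.FluidPDE.Torus.nsGeneratorPairing (ν j) f u (fun x => ∑ i : Fin m, (MvPolynomial.eval (fun j => Literature.Analysis.FluidPDE.Torus.pairing u.1 (g j)) (MvPolynomial.pderiv i P)) • g i x) ∂μ = 0) ∧ Literature.Analysis.FluidPDE.Torus.ensembleEnergy μ ≤ E ∧ ε ≤ Literature.Analysis.FluidPDE.Torus.ensembleDissipation (ν j) μ) → ∃ E' ε' : ℝ, 0 < ε' ∧ ∀ j : ℕ, ∃ᶠ N in Filter.atTop, ∃ μ : MeasureTheory.Measure (Literature.Analysis.FunctionSpaces.Torus.energySpace (Fin 3)), MeasureTheory.IsProbabilityMeasure μ ∧ (∀ᵐ (u : Literature.Analysis.FunctionSpaces.Torus.energySpace (Fin 3)) ∂μ, (∀ k ∉ (Literature.Analysis.FunctionSpaces.Torus.freqBall N).erase (0 : Fin 3 → ℤ), UnitAddTorus.mFourierCoeff (Literature.Analysis.FunctionSpaces.EuclideanSpace.complexify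 ∘ (u.1 : UnitAddTorus (Fin 3) → EuclideanSpace ℝ (Fin 3))) k = 0)) ∧ MeasureTheory.Integrable (fun u => ‖u‖ ^ 4) μ ∧ (∀ (m : ℕ) (g : Fin m → UnitAddTorus (Fin 3) → EuclideanSpace ℝ (Fin 3)) (P : MvPolynomial (Fin m) ℝ), (∀ i, (Literature.Analysis.FunctionSpaces.Torus.IsSmooth (g i) ∧ Literature.Analysis.FunctionSpaces.Torus.IsDivFree (g i) ∧ Literature.Analysis.FunctionSpaces.Torus.HasZeroMean (g i) ∧ (∀ k ∉ (Literature.Analysis.FunctionSpaces.Torus.freqBall N).erase (0 : Fin 3 → ℤ), UnitAddTorus.mFourierCoeff (Literature.Analysis.FunctionSpaces.EuclideanSpace.complexify ∘ (g i)) k = 0))) → P.totalDegree + 1 ≤ 4 → MeasureTheory.Integrable (fun u => Literature.Analysis.FluidPDE.Torus.nsGeneratorPairing (ν j) f u (fun x => ∑ i : Fin m, (MvPolynomial.eval (fun j => Literature.Analysis.FluidPDE.Torus.pairing u.1 (g j)) (MvPolynomial.pderiv i P)) • g i x)) μ ∧ ∫ u, Literature.Analysis.FluidPDE.Torus.nsGeneratorPairing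 (ν j) f u (fun x => ∑ i : Fin m, (MvPolynomial.eval (fun j => Literature.Analysis.FluidPDE.Torus.pairing u.1 (g j)) (MvPolynomial.pderiv i P)) • g i x) ∂μ = 0) ∧ Literature.Analysis.FluidPDE.Torus.ensembleEnergy μ ≤ E' ∧ ε' ≤ Literature.Analysis.FluidPDE.Torus.ensembleDissipation (ν j) μ

/-- item stmt-AnomalousDissipation-11467 · support · rank 9 · closed · proved by Summit.AnomalousDissipation.AnomalousDissipation.Theorems.momentClosure_proof (prover) · by planner
sources: FMRT2001, doi:10.3934/dcdsb.2019165, arXiv:1807.08956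
[support] at fixed (f, ν, N, E, ε, R, κ): loud d-stationary measures for every d with the common
support ball and tail schedule ⇒ one loud Galerkin-invariant measure with the same bounds. Weak-*
compactness on the compact set P_N H ∩ B_R (a closed ball of a finite-dimensional subspace of H), on
which every generator integrand is a continuous polynomial and energy, enstrophy and the truncated
enstrophies are continuous and bounded (limits with equality); C¹-density of polynomials on compacta
(Bernstein/Nachbin) upgrades polynomial tests to the compactly supported cylindrical ones.
[difficulty: provable-now] -/
@[route_item "route-AnomalousDissipation-MomentParity", crux]
def MomentClosure : Prop :=
  ∀ f : UnitAddTorus (Fin 3) → EuclideanSpace ℝ (Fin 3), Literature.Analysis.FunctionSpaces.Torus.IsSmooth f → Literature.Analysis.FunctionSpaces.Torus.IsDivFree f → Literature.Analysis.FunctionSpaces.Torus.HasZeroMean f → ∀ (ν : ℝ) (N : ℕ) (E ε R : ℝ) (κ : ℕ → ℕ), 0 < ν → (∀ d : ℕ, ∃ μ : MeasureTheory.Measure (Literature.Analysis.FunctionSpaces.Torus.energySpace (Fin 3)), MeasureTheory.IsProbabilityMeasure μ ∧ (∀ᵐ (u : Literature.Analysis.FunctionSpaces.Torus.energySpace (Fin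 3)) ∂μ, (∀ k ∉ (Literature.Analysis.FunctionSpaces.Torus.freqBall N).erase (0 : Fin 3 → ℤ), UnitAddTorus.mFourierCoeff (Literature.Analysis.FunctionSpaces.EuclideanSpace.complexify ∘ (u.1 : UnitAddTorus (Fin 3) → EuclideanSpace ℝ (Fin 3))) k = 0)) ∧ (∀ᵐ u ∂μ, ‖u‖ ≤ R) ∧ (∀ n : ℕ, ∫⁻ (u : Literature.Analysis.FunctionSpaces.Torus.energySpace (Fin 3)), Literature.Analysis.FunctionSpaces.Torus.eGradNormSq (u.1 : UnitAddTorus (Fin 3) → EuclideanSpace ℝ (Fin 3)) ∂μ ≤ (∫⁻ (u : Literature.Analysis.FunctionSpaces.Torus.energySpace (Fin 3)), Literature.Analysis.FunctionSpaces.Torus.eGradNormSq (Literature.Analysis.FunctionSpaces.Torus.fourierTruncate (κ n) (u.1 : UnitAddTorus (Fin 3) → EuclideanSpace ℝ (Fin 3))) ∂μ) + ((n : ENNReal) + 1)⁻¹) ∧ (∀ (m : ℕ) (g : Fin m → UnitAddTorus (Fin 3) → EuclideanSpace ℝ (Fin 3)) (P : MvPolynomial (Fin m) ℝ), (∀ i,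 (Literature.Analysis.FunctionSpaces.Torus.IsSmooth (g i) ∧ Literature.Analysis.FunctionSpaces.Torus.IsDivFree (g i) ∧ Literature.Analysis.FunctionSpaces.Torus.HasZeroMean (g i) ∧ (∀ k ∉ (Literature.Analysis.FunctionSpaces.Torus.freqBall N).erase (0 : Fin 3 → ℤ), UnitAddTorus.mFourierCoeff (Literature.Analysis.FunctionSpaces.EuclideanSpace.complexify ∘ (g i)) k = 0))) → P.totalDegree + 1 ≤ d → MeasureTheory.Integrable (fun u => Literature.Analysis.FluidPDE.Torus.nsGeneratorPairing ν f u (fun x => ∑ i : Fin m, (MvPolynomial.eval (fun j => Literature.Analysis.FluidPDE.Torus.pairing u.1 (g j)) (MvPolynomial.pderiv i P)) • g i x)) μ ∧ ∫ u, Literature.Analysis.FluidPDE.Torus.nsGeneratorPairing ν f u (fun x => ∑ i : Fin m, (MvPolynomial.eval (fun j => Literature.Analysis.FluidPDE.Torus.pairing u.1 (g j)) (MvPolynomial.pderiv i P)) • g i x) ∂μ = 0) ∧ Literature.Analysis.FluidPDE.Torus.ensembleEnergy μ ≤ E ∧ ε ≤ Literature.Analysis.FluidPDE.Torus.ensembleDissipation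 ν μ) → ∃ μ : MeasureTheory.Measure (Literature.Analysis.FunctionSpaces.Torus.energySpace (Fin 3)), MeasureTheory.IsProbabilityMeasure μ ∧ (∀ᵐ (u : Literature.Analysis.FunctionSpaces.Torus.energySpace (Fin 3)) ∂μ, (∀ k ∉ (Literature.Analysis.FunctionSpaces.Torus.freqBall N).erase (0 : Fin 3 → ℤ), UnitAddTorus.mFourierCoeff (Literature.Analysis.FunctionSpaces.EuclideanSpace.complexify ∘ (u.1 : UnitAddTorus (Fin 3) → EuclideanSpace ℝ (Fin 3))) k = 0)) ∧ (∀ᵐ u ∂μ, ‖u‖ ≤ R) ∧ (∀ n : ℕ, ∫⁻ (u : Literature.Analysis.FunctionSpaces.Torus.energySpace (Fin 3)), Literature.Analysis.FunctionSpaces.Torus.eGradNormSq (u.1 : UnitAddTorus (Fin 3) → EuclideanSpace ℝ (Fin 3)) ∂μ ≤ (∫⁻ (u : Literature.Analysis.FunctionSpaces.Torus.energySpace (Fin 3)), Literature.Analysis.FunctionSpaces.Torus.eGradNormSq (Literature.Analysis.FunctionSpaces.Torus.fourierTruncate (κ n) (u.1 : UnitAddTorus (Fin 3) → EuclideanSpace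 ℝ (Fin 3))) ∂μ) + ((n : ENNReal) + 1)⁻¹) ∧ (∀ Φ : Literature.Analysis.FluidPDE.Torus.CylindricalTest (Fin 3), (∀ i, (∀ k ∉ (Literature.Analysis.FunctionSpaces.Torus.freqBall N).erase (0 : Fin 3 → ℤ), UnitAddTorus.mFourierCoeff (Literature.Analysis.FunctionSpaces.EuclideanSpace.complexify ∘ (Φ.g i)) k = 0)) → MeasureTheory.Integrable (fun u => Literature.Analysis.FluidPDE.Torus.nsGeneratorPairing ν f u (Φ.grad u)) μ ∧ ∫ u, Literature.Analysis.FluidPDE.Torus.nsGeneratorPairing ν f u (Φ.grad u) ∂μ = 0) ∧ Literature.Analysis.FluidPDE.Torus.ensembleEnergy μ ≤ E ∧ ε ≤ Literature.Analysis.FluidPDE.Torus.ensembleDissipation ν μ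

/-- item stmt-AnomalousDissipation-11468 · support · rank 9 · closed · proved by Summit.AnomalousDissipation.AnomalousDissipation.Theorems.planarCubicQuiet_proof (prover) · by planner
sources: doi:10.1016/j.physleta.2006.07.048, Literature.Barriers.AnomalousDissipation.AlexakisDoering2006_energyDissipationBound, FMRT2001
[support] card T2, on T²: for every smooth div-free mean-zero f and E ≥ 0 there is C (=
‖Δf‖₂^{1/2}E^{3/4}) such that for every ν > 0, every N and every level-N probability measure with
finite third moments that is 3-stationary with mean energy ≤ E: dissipation ≤ C√ν. The enstrophy
budget (b(u,u,Au) = 0 on T²) is the range condition ν∫‖Au‖² = ∫(u, Af) ≤ ‖Δf‖₂√E, and ‖∇u‖² ≤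
|u|‖Au‖ — Alexakis–Doering IS quadratic stationarity's enstrophy range condition; calibrates the
inlined definitions on the quiet side of the parity criterion. [difficulty: provable-now] -/
@[route_item "route-AnomalousDissipation-MomentParity"]
def PlanarCubicQuiet : Prop :=
  ∀ f : UnitAddTorus (Fin 2) → EuclideanSpace ℝ (Fin 2), Literature.Analysis.FunctionSpaces.Torus.IsSmooth f → Literature.Analysis.FunctionSpaces.Torus.IsDivFree f → Literature.Analysis.FunctionSpaces.Torus.HasZeroMean f → ∀ E : ℝ, 0 ≤ E → ∃ C : ℝ, ∀ ν : ℝ, 0 < ν → ∀ N : ℕ, ∀ μ : MeasureTheory.Measure (Literature.Analysis.FunctionSpaces.Torus.energySpace (Fin 2)), MeasureTheory.IsProbabilityMeasure μ → (∀ᵐ (u : Literature.Analysis.FunctionSpaces.Torus.energySpace (Fin 2)) ∂μ, (∀ k ∉ (Literature.Analysis.FunctionSpaces.Torus.freqBall N).erase (0 : Fin 2 → ℤ), UnitAddTorus.mFourierCoeff (Literature.Analysis.FunctionSpaces.EuclideanSpace.complexify ∘ (u.1 : UnitAddTorus (Fin 2) → EuclideanSpace ℝ (Fin 2))) k = 0))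 → MeasureTheory.Integrable (fun u => ‖u‖ ^ 3) μ → (∀ (m : ℕ) (g : Fin m → UnitAddTorus (Fin 2) → EuclideanSpace ℝ (Fin 2)) (P : MvPolynomial (Fin m) ℝ), (∀ i, (Literature.Analysis.FunctionSpaces.Torus.IsSmooth (g i) ∧ Literature.Analysis.FunctionSpaces.Torus.IsDivFree (g i) ∧ Literature.Analysis.FunctionSpaces.Torus.HasZeroMean (g i) ∧ (∀ k ∉ (Literature.Analysis.FunctionSpaces.Torus.freqBall N).erase (0 : Fin 2 → ℤ), UnitAddTorus.mFourierCoeff (Literature.Analysis.FunctionSpaces.EuclideanSpace.complexify ∘ (g i)) k = 0))) → P.totalDegree + 1 ≤ 3 → MeasureTheory.Integrable (fun u => Literature.Analysis.FluidPDE.Torus.nsGeneratorPairing ν f u (fun x => ∑ i : Fin m, (MvPolynomial.eval (fun j => Literature.Analysis.FluidPDE.Torus.pairing u.1 (g j)) (MvPolynomial.pderiv i P)) • g i x)) μ ∧ ∫ u, Literature.Analysis.FluidPDE.Torus.nsGeneratorPairing ν f u (fun x => ∑ i : Fin m, (MvPolynomial.eval (fun j => Literature.Analysis.FluidPDE.Torus.pairing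 u.1 (g j)) (MvPolynomial.pderiv i P)) • g i x) ∂μ = 0) → Literature.Analysis.FluidPDE.Torus.ensembleEnergy μ ≤ E → Literature.Analysis.FluidPDE.Torus.ensembleDissipation ν μ ≤ C * Real.sqrt ν

/-- item stmt-AnomalousDissipation-14285 · support · rank 9 · closed · proved by Summit.AnomalousDissipation.AnomalousDissipation.Theorems.ladderGlue_proof @ 0fc26a317730 (prover) · by planner
sources: FMRTTurbulence2001
[support — glue of the split MomentLadder ⇐ GalerkinInvariantLoud ∧ ResolvedDissipation; pure logic,
provable now] Unpack f, ν_j, E, ε from GalerkinInvariantLoud; at each j take its support radius R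
and the schedule κ that ResolvedDissipation assigns to (f, ν_j, R); inside the `∃ᶠ N` the invariant
loud measure μ is d-stationary for every d (drop the degree hypothesis `P.totalDegree + 1 ≤ d`) and
κ-resolved by ResolvedDissipation: this is MomentLadder verbatim. Checked: planner Sketch.lean
`ladderGlue_holds` (kernel-closed, lean check rc 0, 9 tactic lines). -/
@[route_item "route-AnomalousDissipation-MomentParity", crux]
def LadderGlue : Prop :=
  GalerkinInvariantLoud → ResolvedDissipation → MomentLadder

/-- item stmt-AnomalousDissipation-14332 · support · rank 9 · closed · proved by Summit.AnomalousDissipation.AnomalousDissipation.Theorems.ladderGlue2_proof @ dffdaa70ec81 (prover) · by planner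
sources: FMRT2001
[support] GLUE of the cruxes into the target: QuarticGate → QuarticTightness → UniformResolution →
MomentLadder. PROVED in the planner's Sketch.lean (pure logic, 5 lines): obtain ⟨f, hfs, hfd, hfz,
ν, E, ε, hν, hν0, hε, hj⟩ from QuarticGate; QuarticTightness f … hj gives ⟨E₁, ε₁, hε₁, h₁⟩;
UniformResolution f … h₁ gives ⟨E₂, ε₂, hε₂, h₂⟩; exact ⟨f, hfs, hfd, hfz, ν, E₂, ε₂, hν, hν0, hε₂,
h₂⟩ — the bodies are verbatim copies of the QuarticGate / MomentLadder bodies. Provable now; any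
idle prover lands it. [deps: QuarticGate, QuarticTightness, UniformResolution, MomentLadder]
[difficulty: provable-now] -/
@[route_item "route-AnomalousDissipation-MomentParity"]
def LadderGlue2 : Prop :=
  QuarticGate → QuarticTightness → UniformResolution → MomentLadder

/-- item stmt-AnomalousDissipation-14841 · support · rank 9 · closed · proved by Summit.AnomalousDissipation.AnomalousDissipation.Theorems.ladderGlue3_proof @ 15c49798f5b8 (prover) · by planner
sources: FMRT2001, doi:10.1017/s0022112073001837
[support — glue of the d = 3 rung into the cone of `closes`; pure logic, PROVED in the planner's
Sketch.lean (`ladderGlue3_holds`: 12 tactic lines, kernel-closed, axioms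
propext/Classical.choice/Quot.sound, lean check rc 0)] CubicParityLoud → CubicClimb → QuarticGate:
instantiate CubicParityLoud at the shear (Kolmogorov) force cos(2πx₁)e₂ = `Torus.frameField
(Pi.single 0 1) 1 true` (smooth / div-free / mean-zero / ≠ 0: `isSmooth_shearForce`,
`isDivFree_shearForce`, `hasZeroMean_shearForce`, `shearForce_ne_zero` in
Theorems/CubicParityLoud/Negative/Clauses.lean, i.e. `Torus.isSmooth_realTrigPoly`,
`Torus.isDivFree_frameField`, `Torus.integral_frameField`), obtaining E, ε, ν₀; put ν_j := ν₀/(j+2)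
(positive, < ν₀ by `div_lt_self`, → 0 by `tendsto_const_nhds.div_atTop`); "∀ N ≥ N₀(ν_j) ∃ μ …"
gives "∃ᶠ N, ∃ μ …" (`Filter.eventually_atTop` + `Filter.Eventually.frequently`), the per-μ bodies
agreeing verbatim; CubicClimb at (shearForce, ν, E, ε) returns E′, ε′ and the QuarticGate body;
repack ⟨shearForce, _, _, _, ν, E′, ε′, _, _, _, _⟩. Any idle prover lands it (import the Clauses
file or re-derive the four force lemmas from Literature.Analysis.FunctionSpaces.TorusTrigPoly).
[deps: Cubi -/
@[route_item "route-AnomalousDissipation-MomentParity"]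
def LadderGlue3 : Prop :=
  CubicParityLoud → CubicClimb → QuarticGate

/-- item stmt-AnomalousDissipation-11469 · assembly · rank 1 · closed · proved by Summit.AnomalousDissipation.AnomalousDissipation.Theorems.momentParity_assembly_proof (prover) · by planner
sources: FMRT2001, doi:10.1137/130931631
[assembly] MomentLadder → MomentClosure → GalerkinEnsembleRealization → AnomalousDissipation. -/
@[route_item "route-AnomalousDissipation-MomentParity"]
def Assembly : Prop :=
  MomentLadder → MomentClosure → GalerkinEnsembleRealization → AnomalousDissipation

/-! D-0027 §2.1 — DECIDING THEOREM (planner-authored via `route open/edit --closes-file`; by planner-rbadge-AnomalousDissipation-MomentPari-509ed388-g3-0 2026-08-16T09:30:16Z):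
its hypotheses are this route's items and its conclusion the sub-problem Statement (glue_lint), and it elaborates with this file. -/

@[closes "route-AnomalousDissipation-MomentParity"] theorem closes : GalerkinInvariantLoud → ResolvedDissipation → LadderGlue → MomentClosure → GalerkinEnsembleRealization → _root_.AnomalousDissipation := by
  -- D-0027 §2.1 deciding theorem, crux-only shape (re-certified 2026-08-16 by the g3 badge seat after the
  -- MomentParity / QuarticLadder split; statement and proof identical to rev 8). Binders: the cruxes
  -- `GalerkinInvariantLoud` (d = ∞ rung: loud bounded Galerkin-invariant ensembles along ν_j → 0),
  -- `ResolvedDissipation` (N-uniform resolution of the mean enstrophy at fixed ν) and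
  -- `GalerkinEnsembleRealization` (one Leray–Hopf path shadowing the loud invariant Galerkin laws), plus the
  -- PROVED supports `LadderGlue : GalerkinInvariantLoud → ResolvedDissipation → MomentLadder`
  -- (Theorems/MomentParityLadderGlue) and `MomentClosure` (Theorems/MomentParityMomentClosure).
  -- The crux X = `MomentLadder` (rank 0) is DERIVED on the first line, so it is no hypothesis. Then: unpack
  -- the force `f`, the viscosities `ν j → 0` and the budgets `E`, `ε`; at each `j`, `MomentClosure` turns
  -- "loud d-stationary measures for every d (common support ball, resolved dissipation)" into a loud
  -- Galerkin-INVARIANT measure at frequently many levels `N`, and `GalerkinEnsembleRealization` (with its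
  -- `j`-independent `M = M(f, E, ε)`) shadows them by ONE global Leray–Hopf trajectory with
  -- `meanEnergy ≤ M` and `meanDissipation ≥ ε / 2`: these witness `Literature.Turb.ZerothLaw`
  -- (= `AnomalousDissipation`) with constants `M`, `ε / 2`.
  intro hG hRes hL hC hR
  have hX : MomentLadder := hL hG hRes
  obtain ⟨f, hfs, hfd, hfz, ν, E, ε, hν, hν0, hε, hj⟩ := hX
  obtain ⟨M, hM⟩ := hR f hfs hfd hfz E ε hε
  have key : ∀ j : ℕ, ∃ (u₀ : UnitAddTorus (Fin 3) → EuclideanSpace ℝ (Fin 3))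
      (u : ℝ → UnitAddTorus (Fin 3) → EuclideanSpace ℝ (Fin 3)),
      Literature.Analysis.FluidPDE.Torus.IsGlobalLerayHopf (ν j) (fun _ => f) u₀ u ∧
        Literature.Analysis.FluidPDE.meanEnergy u ≤ M ∧
          ε / 2 ≤ Literature.Analysis.FluidPDE.meanDissipation (ν j) u := by
    intro j
    obtain ⟨R, κ, hfreq⟩ := hj j
    exact hM (ν j) (hν j) R κ (hfreq.mono fun N hN => hC f hfs hfd hfz (ν j) N E ε R κ (hν j) hN)
  choose u₀ u hu using key
  unfold _root_.AnomalousDissipation Literature.Turb.ZerothLaw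
  exact ⟨f, hfs, hfd, hfz, ν, u₀, u, hν, hν0, fun j => (hu j).1, ⟨M, fun j => (hu j).2.1⟩,
    ε / 2, half_pos hε, fun j => (hu j).2.2⟩

end Summit.AnomalousDissipation.AnomalousDissipation.Theses.MomentParity
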